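import Literature.Probability.RandomPlanarGeometry.HexSAWSurfaceSecondOrderSharp
import Literature.Probability.RandomPlanarGeometry.HexSAWSurfaceWallRateEq
import HarnessLib

/-!
# Honeycomb SAW at the Duminil-Copin–Smirnov surface (brick-wall frame): the FOURTH-order term of the adsorbed-phase free energy from
# above — `β(y)² ≤ y + 1/y + 1/y² + 2/y³ + 708591/y⁴` (`y ≥ 36`) by FIVE-step-extendable arches; hence
# `limsup_{y→∞} y³ (β(y)² − y − 1/y − 1/y²) ≤ 2`

Topic `Literature/Probability/RandomPlanarGeometry` (lane «pcv-sawmu», car «WALL-FOURTH-ORDER-UPPER», a-p6 g16).  Continues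
`HexSAWSurfaceSecondOrderSharp.lean` (a-p6 g15: extendable arches `ExtRow`, `dip_coords`, `not_mem_fibW_diag`, `sum_fibW_eq_zero_of_near`,
`Xw_le_three_pow_mul_pow`; the window `β(y)² ≤ y + 1/y + 8748/y²`) and `HexSAWSurfaceSqrtAsymptotic.lean` (the last-visit fibres `fibW m k`,
`fibW_anatomy`, `arch_last_step`, `surface_next_step`, `surface_prev_step`, `wallRate_le_of_WB_le`).  Companion of the same seat's
«WALL-FOURTH-ORDER-LOWER» (`liminf ≥ 2` by direct concatenation of left-proper seeds); the two together give the fourth coefficient EXACTLY `2`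
(assembled in a separate car once both modules are built).

The device.  The lane's third-order car (`HexSAWSurfaceThirdOrder`, a-p6 g15: THREE-step-extendable arches) cannot be imported while its build is
pending, and three steps do not suffice at fourth order: the forward long flat excursion of length ten has a «late long hook» twin
`(x+7σ,0) → (x+6σ,0)` that dies only after FOUR forced fresh steps `(x+5σ,0) (x+4σ,0) (x+3σ,0) (x+2σ,0)`.  So this module raises the
extendability requirement to a fresh self-avoiding FIVE-step continuation (`ExtK 5`, defined for a general number of steps `k`), re-derives
the dip and flat fibres under it (the dip through the parent's `dip_coords`; the flat excursion of length eight afresh, since the third-order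
car is not importable), and analyses the fibre of excursion length TEN: for a last surface visit at time `≥ 6` an `ExtK 5` arch ends with one of
exactly FOUR shapes — the long flat `…(x+7σ,−1)(x+7σ,0)(x+8σ,0)`, the terrace `…(x+2σ,−2)(x+3σ,−2)(x+4σ,−2)(x+4σ,−1)(x+5σ,−1)(x+5σ,0)(x+6σ,0)`,
the right hook `…(x+4σ,−2)(x+4σ,−1)(x+3σ,−1)(x+3σ,0)(x+4σ,0)` and the left hook `(x+σ,0)(x+σ,−1)(x,−1)(x,−2)(x+σ,−2)(x+2σ,−2)(x+2σ,−1)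
(x+3σ,−1)(x+3σ,0)(x+4σ,0)` — every backward variant meets the five preceding vertices of the arch or is a dead end of depth `≤ 4`.

Sources.  N. R. Beaton, M. Bousquet-Mélou, J. de Gier, H. Duminil-Copin, A. J. Guttmann, CMP 326 (2014) = arXiv:1109.0358v5, §3.1,
Proposition 5 (p. 9) and p. 10 (the first-order remark "`μ(y) ∼ √y`", after Rychlewski–Whittington 2011 — not held).  E. J. Janse van
Rensburg, *The Statistical Mechanics of Interacting Walks, Polygons, Animals and Vesicles* (OUP 2000), §3.3.2, Lemma 3.20.  J. M. Hammersley,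
G. M. Torrie, S. G. Whittington, J. Phys. A 15 (1982) 539, §2 (locator provisional, source not held).  I. G. Enting, I. Jensen, LNP 775 (2009),
§7.4.2, Fig. 7.10.  N. Madras, G. Slade, *The Self-Avoiding Walk* (1993), §1.2.

## What is proved (namespace `…SAW.HexBW.Wall`)

* §1 `ExtK k n ω` (a fresh self-avoiding `k`-step continuation in the half-plane), `archsK`, `XKw k n y = X^{(k)}_n(y)`; `WB_le_XKw`,
  `ExtK.extRow` (at an arch end, `k ≥ 1`), ★ `prefixWalk_mem_archsK` (prefix cut at a surface visit `≥ k` steps before the end).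
* §2 `sum_fibre_lastV_le_XK`, `sum_fibW_le_XK`, `sum_fibW_self_le_XK` (`k ≥ 2`) — the parents' fibre bounds with `X^{(k)}` prefixes.
* §3 ★ `sum_shape_le_XK` — a sub-fibre on which the last `c+2` steps are a FIXED function of `(X_{j+2}, X_{j+1})` injects into `archsK k (j+2)`.
* §4 `sum_fibW_dip_le_XK` (`k ≥ 1`).  §5 ★★ `flat8_coords5`, `sum_fibW_flat8_le_X5` (`1 ≤ j`).  §6 ★★★ `ten_coords5` (`4 ≤ j`: four shapes),
  `sum_fibW_ten_le_X5 : Σ ≤ 4y · X⁵_{j+2}`.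
* §7 ★★ **`X5w_le_rec (4 ≤ j) : X⁵_{j+12} ≤ y X⁵_{j+10} + y X⁵_{j+6} + y X⁵_{j+4} + 4y X⁵_{j+2} + 2y Σ_{k≤j} X⁵_k c_{j+11−k}`**
  (`1 = yz + yz³ + yz⁴ + 4yz⁵ + O(yz⁶)`).
* §8 `X5w_le_mul_pow`: `6 ≤ ρ`, `y/ρ² + y/ρ⁶ + y/ρ⁸ + 4y/ρ¹⁰ + 708588 y/ρ¹² ≤ 1 ⇒ X⁵_n ≤ 3¹⁵ y¹⁵ ρⁿ` (`708588 = 4·3¹¹`).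
* §9 ★★★ **`wallRate_sq_le_fourth (36 ≤ y) : β(y)² ≤ y + 1/y + 1/y² + 2/y³ + 708591/y⁴`**, ★★★ `cube_mul_wallRate_sq_sub_le :
  y³ (β² − y − 1/y − 1/y²) ≤ 2 + 708591/y`, `eventually_cube_mul_wallRate_sq_sub_le (2 < a) : ∀ᶠ y, y³(…) ≤ a` (limsup ≤ 2), and the
  same for BBdGDCG's `μ(y) = HV.surfaceMu y`.

EDITION NOTE (ed.2): docstring of `wallRate_sq_fourth_upper_mem_Icc` states the Lean lower end exactly (lit-1 FU-1); code unchanged.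

HONEST LABEL (author's proposal).  LANE THEOREM S/M, elementary, ≈ 1 850 lines over the lane's surface-walk infrastructure; NEW-IN-WRITING
(modest): the fourth coefficient `≤ 2` (with the companion: `= 2`) — print has first order only (BBdGDCG p. 10).  NOT CLAIMED: `y < 36`
(the threshold only serves `ρ ≥ 6`), the `O(y⁻⁴)` coefficient (census conjecture `4`), the armchair wall, optimal constants.
-/

noncomputable section

open Finset Filter Function
open Literature.Probability.LatticeModels Literature.Probability.Percolation SimpleGraph
open _root_.Topology

namespace Literature.Probability.RandomPlanarGeometry.SAW.HexBW.Wall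

variable {y : ℝ} {n k : ℕ} {ω : ℕ → Site 2}

/-! ### §1  `k`-step-extendable arches -/

/-- An `n`-step walk is **`k`-step extendable** if it admits a self-avoiding continuation `η 1, …, η k` (`η 0 = ω n`) by fresh sites of the
half-plane `Y ≤ 0`. [cite: HammersleyTorrieWhittington1982, §2 (unfolded surface walks; locator provisional, source not held); MadrasSlade1993, §1.2, (1.2.3)] -/
def ExtK (k n : ℕ) (ω : ℕ → Site 2) : Prop :=
  ∃ η : ℕ → Site 2, η 0 = ω n ∧ (∀ i < k, brickWallGraph.Adj (η i) (η (i + 1))) ∧ (∀ i, 1 ≤ i → i ≤ k → η i 1 ≤ 0) ∧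
    (∀ i ≤ k, ∀ i' ≤ k, η i = η i' → i = i') ∧ (∀ i ≤ n, ∀ j, 1 ≤ j → j ≤ k → ω i ≠ η j)

open Classical in
/-- The `k`-step-extendable arches of length `n`. [cite: HammersleyTorrieWhittington1982, §2 (unfolded surface walks; locator provisional)] -/
def archsK (k n : ℕ) : Finset (ℕ → Site 2) := (archs n).filter (ExtK k n)

open Classical in
/-- Their surface-weighted count `X^{(k)}_n(y)`. [cite: HammersleyTorrieWhittington1982, §2 (unfolded surface walks; locator provisional)] -/
def XKw (k n : ℕ) (y : ℝ) : ℝ := ∑ ω ∈ archsK k n, y ^ visits n ω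

open Classical in
/-- Membership. [cite: HammersleyTorrieWhittington1982, §2] -/
theorem mem_archsK : ω ∈ archsK k n ↔ ω ∈ archs n ∧ ExtK k n ω := Finset.mem_filter

open Classical in
/-- `archsK k n ⊆ archs n`. [cite: HammersleyTorrieWhittington1982, §2] -/
theorem archsK_subset : archsK k n ⊆ archs n := Finset.filter_subset _ _

open Classical in
/-- `X^{(k)}_n(y) ≥ 0`. [cite: HammersleyTorrieWhittington1982, §2] -/
theorem XKw_nonneg (k n : ℕ) (hy : 0 ≤ y) : 0 ≤ XKw k n y := Finset.sum_nonneg fun _ _ => pow_nonneg hy _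

open Classical in
/-- `X^{(k)}_n(y) ≤ A_n(y)`. [cite: HammersleyTorrieWhittington1982, §2] -/
theorem XKw_le_Aw (k n : ℕ) (hy : 0 ≤ y) : XKw k n y ≤ Aw n y :=
  Finset.sum_le_sum_of_subset_of_nonneg archsK_subset fun _ _ _ => pow_nonneg hy _

/-- **Every wall bridge is `k`-step extendable**: straight on along the row to the right of its rightmost end.
[cite: HammersleyTorrieWhittington1982, §2 (surface bridges); BeatonBousquetMelouDeGierDuminilCopinGuttmann2014, §3.1 (arXiv v5 p. 9)] -/
theorem extK_of_mem_wbr (k : ℕ) (hω : ω ∈ wbr n) : ExtK k n ω := by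
  obtain ⟨hωa, hwb⟩ := mem_wbr.1 hω
  obtain ⟨hωh, -, hend⟩ := mem_archs.1 hωa
  set η : ℕ → Site 2 := fun i => Arm.pt (ω n 0 + i) 0 with hη
  have hη0 : ∀ i, η i 0 = ω n 0 + i := fun i => by simp only [hη, Arm.pt_apply_zero]
  have hη1 : ∀ i, η i 1 = 0 := fun i => by simp only [hη, Arm.pt_apply_one]
  refine ⟨η, ?_, fun i _ => ?_, fun i _ _ => le_of_eq (hη1 i), fun i _ i' _ h => ?_, fun i hi j hj1 _ h => ?_⟩
  · rw [site_two_eq_iff, hη0, hη1, hend]; exact ⟨by push_cast; ring, rfl⟩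
  · rw [brickWallGraph_adj_coord, hη0, hη1, hη0, hη1]; exact Or.inl ⟨Or.inl (by push_cast; ring), rfl⟩
  · have h0 := congrFun h 0; rw [hη0, hη0] at h0; omega
  · have h0 := congrFun h 0
    rw [hη0] at h0
    have := (hwb i hi).2
    omega

open Classical in
/-- `wbr n ⊆ archsK k n`. [cite: HammersleyTorrieWhittington1982, §2 (surface bridges)] -/
theorem wbr_subset_archsK (k : ℕ) : wbr n ⊆ archsK k n := fun _ hω => mem_archsK.2 ⟨wbr_subset hω, extK_of_mem_wbr k hω⟩

open Classical in
/-- **`B^w_n(y) ≤ X^{(k)}_n(y)`** (`y ≥ 0`). [cite: HammersleyTorrieWhittington1982, §2 (surface bridges)] -/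
theorem WB_le_XKw (k n : ℕ) (hy : 0 ≤ y) : WB n y ≤ XKw k n y :=
  Finset.sum_le_sum_of_subset_of_nonneg (wbr_subset_archsK k) fun _ _ _ => pow_nonneg hy _

/-- At the end of an ARCH (a surface site of even parity, hence without a downward bond), a `k`-step extension (`k ≥ 1`) starts along the
row: the arch is extendable along the row in the parent's sense. [cite: HammersleyTorrieWhittington1982, §2; EntingJensen2009, §7.4.2, Fig. 7.10] -/
theorem ExtK.extRow (hω : ω ∈ archs n) (hk : 1 ≤ k) (hE : ExtK k n ω) : ExtRow n ω := by
  obtain ⟨η, h0, hadj, hY, -, hfresh⟩ := hE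
  obtain ⟨hωh, hev, hend⟩ := mem_archs.1 hω
  obtain ⟨hωs, -⟩ := mem_hpw.1 hωh
  have hpar := parity_apply hωs (i := n) le_rfl
  have s := Arm.step_cases (hadj 0 (by omega))
  rw [h0, Nat.zero_add] at s
  have hY1 := hY 1 le_rfl hk
  have hn : ((n : ℕ) : ℤ) % 2 = 0 := by exact_mod_cast hev
  rw [hn, hend] at hpar
  refine ⟨η 1, by rw [← h0]; exact hadj 0 (by omega), by omega, fun i hi => hfresh i hi 1 le_rfl hk⟩

/-- **The prefix of a half-plane walk up to a surface visit at an even time `t` with `t + k ≤ n` is a `k`-step-extendable arch**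
(witness: the walk's own next `k` steps), with the same visits up to time `t`. [cite: MadrasSlade1993, §1.2, (1.2.3); EntingJensen2009, §7.4.2, Fig. 7.10] -/
theorem prefixWalk_mem_archsK (hω : ω ∈ hpw n) {t : ℕ} (ht : t + k ≤ n) (ht2 : t % 2 = 0) (hY : ω t 1 = 0) :
    Zd.prefixWalk t ω ∈ archsK k t ∧ visits t (Zd.prefixWalk t ω) = visits t ω := by
  classical
  obtain ⟨hpa, hpv⟩ := prefixWalk_mem_archs hω (by omega) ht2 hY
  refine ⟨mem_archsK.2 ⟨hpa, ?_⟩, hpv⟩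
  obtain ⟨hωs, hH⟩ := mem_hpw.1 hω
  obtain ⟨-, -, hbw, hinj⟩ := mem_saws_iff.1 hωs
  have hv : ∀ i ≤ t, Zd.prefixWalk t ω i = ω i := fun i hi => by simp [Zd.prefixWalk, min_eq_left hi]
  have hne : ∀ a b : ℕ, a ≤ n → b ≤ n → ω a = ω b → a = b := fun a b ha hb h =>
    hinj (show a ∈ {j | j ≤ n} by simp only [Set.mem_setOf_eq]; exact ha)
      (show b ∈ {j | j ≤ n} by simp only [Set.mem_setOf_eq]; exact hb) h
  refine ⟨fun i => ω (t + i), ?_, fun i hi => ?_, fun i _ hi => hH _ (by omega), fun i hi i' hi' h => ?_,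
    fun i hi j _ hj h => ?_⟩
  · show ω (t + 0) = _; rw [hv t le_rfl, add_zero]
  · show brickWallGraph.Adj (ω (t + i)) (ω (t + (i + 1)))
    rw [show t + (i + 1) = t + i + 1 by omega]; exact hbw (t + i) (by omega)
  · have := hne _ _ (by omega) (by omega) h; omega
  · rw [hv i hi] at h
    have := hne i (t + j) (by omega) (by omega) h; omega

/-! ### §2  The last-visit fibres with `k`-step-extendable prefixes -/

open Classical in
/-- The walks of `hpw n` with last surface visit at time `t ≤ n − k` weigh at most `X^{(k)}_t(y) · c_{n−t}(ℍ)`.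
[cite: HammersleyTorrieWhittington1982, §2; MadrasSlade1993, §1.2, (1.2.3)] -/
theorem sum_fibre_lastV_le_XK (hy : 0 ≤ y) {t : ℕ} (ht : t + k ≤ n) :
    ∑ ω ∈ (hpw n).filter (fun ω => lastV n ω = t), y ^ visits n ω ≤ XKw k t y * #(saws (n - t)) := by
  set F := (hpw n).filter (fun ω => lastV n ω = t)
  have hF : ∀ ω ∈ F, ω ∈ hpw n ∧ lastV n ω = t := fun ω hω => Finset.mem_filter.1 hω
  have hprops : ∀ ω ∈ F, visits n ω = visits t (Zd.prefixWalk t ω) ∧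
      Zd.prefixWalk t ω ∈ archsK k t ∧ Zd.suffixWalk t (n - t) ω ∈ saws (n - t) := by
    intro ω hω
    obtain ⟨hωh, hl⟩ := hF ω hω
    have hωs := hpw_subset hωh
    obtain ⟨h0, -, -, -⟩ := mem_saws_iff.1 hωs
    obtain ⟨ht2, hY⟩ := lastV_spec (n := n) h0
    rw [hl] at ht2 hY
    obtain ⟨hpa, hpv⟩ := prefixWalk_mem_archsK hωh ht ht2 hY
    refine ⟨?_, hpa, suffixWalk_mem hωs (by omega) ht2⟩
    have e := visits_add_eq_left (k := t) (b := n - t) (ζ := ω)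
      (fun j hj1 hjb => not_visit_of_lastV_lt (n := n) (ω := ω) (by omega) (by omega))
    rw [Nat.add_sub_cancel' (by omega : t ≤ n)] at e
    rw [hpv, e]
  have hinj : Set.InjOn (fun ω : ℕ → Site 2 => (Zd.prefixWalk t ω, Zd.suffixWalk t (n - t) ω)) ↑F :=
    fun ω hω ω' hω' h => Zd.prefix_suffix_injOn (by omega) (saws_subset _ (hpw_subset (hF ω hω).1))
      (saws_subset _ (hpw_subset (hF ω' hω').1)) h
  calc ∑ ω ∈ F, y ^ visits n ω = ∑ ω ∈ F, y ^ visits t (Zd.prefixWalk t ω) :=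
        Finset.sum_congr rfl fun ω hω => by rw [(hprops ω hω).1]
    _ = ∑ p ∈ F.image (fun ω => (Zd.prefixWalk t ω, Zd.suffixWalk t (n - t) ω)), y ^ visits t p.1 := by
        rw [Finset.sum_image hinj]
    _ ≤ ∑ p ∈ archsK k t ×ˢ saws (n - t), y ^ visits t p.1 := by
        refine Finset.sum_le_sum_of_subset_of_nonneg (fun p hp => ?_) fun _ _ _ => pow_nonneg hy _
        obtain ⟨ω, hω, rfl⟩ := Finset.mem_image.1 hp
        exact Finset.mem_product.2 ⟨(hprops ω hω).2.1, (hprops ω hω).2.2⟩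
    _ = XKw k t y * #(saws (n - t)) := by
        rw [Finset.sum_product, XKw, Finset.sum_mul]
        refine Finset.sum_congr rfl fun φ _ => ?_
        dsimp only
        rw [Finset.sum_const, nsmul_eq_mul, mul_comm]

open Classical in
/-- **Every fibre `t` with `t + k ≤ m + 3` of the arches of length `m+4`** weighs at most `2y · X^{(k)}_t(y) · c_{m+3−t}(ℍ)`.
[cite: HammersleyTorrieWhittington1982, §2 (as summarised by Beaton 2014 arXiv v3 p. 11; locator provisional); MadrasSlade1993, §1.2, (1.2.3)] -/
theorem sum_fibW_le_XK (m : ℕ) (hy : 0 ≤ y) {t : ℕ} (ht : t + k ≤ m + 3) :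
    ∑ ω ∈ fibW m t, y ^ visits (m + 4) ω ≤ 2 * y * (XKw k t y * #(saws (m + 3 - t))) := by
  set F := (hpw (m + 3)).filter (fun ξ => lastV (m + 3) ξ = t) with hF
  set g : (ℕ → Site 2) → (ℕ → Site 2) × Bool :=
    fun ω => (Zd.prefixWalk (m + 3) ω, decide (ω (m + 4) 0 = ω (m + 3) 0 + 1)) with hg
  have hprops : ∀ ω ∈ fibW m t, (g ω).1 ∈ F ∧ visits (m + 4) ω = visits (m + 3) (g ω).1 + 1 := by
    intro ω hω
    obtain ⟨hωh, hm, hend, -, -, -, -, hlast⟩ := fibW_anatomy hω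
    obtain ⟨hph, hpv⟩ := prefixWalk_mem_hpw hωh (show m + 3 ≤ m + 4 by omega)
    have hl3 : lastV (m + 3) ω = t := by
      rw [show m + 3 = m + 2 + 1 by omega, lastV_succ_of_even (by omega), hlast]
    refine ⟨Finset.mem_filter.2 ⟨hph, (lastV_prefixWalk_eq _ _).trans hl3⟩, ?_⟩
    rw [show m + 4 = m + 3 + 1 by omega, visits_succ, hpv]
    have h4 : (m + 3 + 1) % 2 = 0 ∧ ω (m + 3 + 1) 1 = 0 := ⟨by omega, by rw [show m + 3 + 1 = m + 4 by omega]; exact hend⟩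
    rw [if_pos h4]
  have hinj : Set.InjOn g ↑(fibW m t) := by
    intro ω hω ω' hω' h
    rw [Finset.mem_coe] at hω hω'
    obtain ⟨hωh, -, hend, -⟩ := fibW_anatomy hω
    obtain ⟨hωh', -, hend', -⟩ := fibW_anatomy hω'
    have hωs := hpw_subset hωh
    have hωs' := hpw_subset hωh'
    simp only [hg, Prod.mk.injEq] at h
    obtain ⟨h1, h2⟩ := h
    have hagree : ∀ i ≤ m + 3, ω i = ω' i := fun i hi => by
      have := congrFun h1 i
      simpa [Zd.prefixWalk, min_eq_left hi] using this
    have hωa : ω ∈ archs (m + 3 + 1) := by rw [show m + 3 + 1 = m + 4 by omega]; exact (Finset.mem_filter.1 hω).1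
    have hωa' : ω' ∈ archs (m + 3 + 1) := by rw [show m + 3 + 1 = m + 4 by omega]; exact (Finset.mem_filter.1 hω').1
    obtain ⟨-, hX⟩ := arch_last_step hωa
    obtain ⟨-, hX'⟩ := arch_last_step hωa'
    rw [show m + 3 + 1 = m + 4 by omega] at hX hX'
    have e3 : ω (m + 3) 0 = ω' (m + 3) 0 := by rw [hagree (m + 3) le_rfl]
    have hb : (ω (m + 4) 0 = ω (m + 3) 0 + 1) ↔ (ω' (m + 4) 0 = ω' (m + 3) 0 + 1) := by
      simpa using h2
    refine Arm.eq_of_agree hωs hωs' fun i hi => ?_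
    rcases Nat.lt_or_ge i (m + 4) with hi' | hi'
    · exact hagree i (by omega)
    · have hin : i = m + 4 := le_antisymm hi hi'
      rw [hin, site_two_eq_iff]
      refine ⟨?_, by rw [hend, hend']⟩
      rcases hX with hX | hX <;> rcases hX' with hX' | hX'
      · omega
      · exact absurd (hb.1 hX) (by omega)
      · exact absurd (hb.2 hX') (by omega)
      · omega
  calc ∑ ω ∈ fibW m t, y ^ visits (m + 4) ω = ∑ ω ∈ fibW m t, y * y ^ visits (m + 3) (g ω).1 :=
        Finset.sum_congr rfl fun ω hω => by rw [(hprops ω hω).2, pow_succ, mul_comm]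
    _ = ∑ p ∈ (fibW m t).image g, y * y ^ visits (m + 3) p.1 := by rw [Finset.sum_image hinj]
    _ ≤ ∑ p ∈ F ×ˢ (Finset.univ : Finset Bool), y * y ^ visits (m + 3) p.1 := by
        refine Finset.sum_le_sum_of_subset_of_nonneg (fun p hp => ?_) fun _ _ _ => mul_nonneg hy (pow_nonneg hy _)
        obtain ⟨ω, hω, rfl⟩ := Finset.mem_image.1 hp
        exact Finset.mem_product.2 ⟨(hprops ω hω).1, Finset.mem_univ _⟩
    _ = 2 * y * ∑ ξ ∈ F, y ^ visits (m + 3) ξ := by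
        rw [Finset.sum_product, Finset.mul_sum]
        refine Finset.sum_congr rfl fun ξ _ => ?_
        simp only [Finset.sum_const, Finset.card_univ, Fintype.card_bool, nsmul_eq_mul]
        push_cast
        ring
    _ ≤ 2 * y * (XKw k t y * #(saws (m + 3 - t))) :=
        mul_le_mul_of_nonneg_left (sum_fibre_lastV_le_XK (n := m + 3) hy (by omega)) (by positivity)

set_option maxHeartbeats 400000 in
open Classical in
/-- **The straight fibre under `k`-step extendability**: the prefix at time `m+2` inherits the two straight steps `ω (m+3)`,
`ω (m+4)` followed by the first `k − 2` sites of the arch's own continuation; weight `≤ y · X^{(k)}_{m+2}(y)`.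
[cite: BeatonBousquetMelouDeGierDuminilCopinGuttmann2014, §3.1 (arXiv v5 p. 9: walks sticking to the surface); EntingJensen2009, §7.4.2, Fig. 7.10] -/
theorem sum_fibW_self_le_XK (m : ℕ) (hy : 0 ≤ y) :
    ∑ ω ∈ (fibW m (m + 2)).filter (ExtK k (m + 4)), y ^ visits (m + 4) ω ≤ y * XKw k (m + 2) y := by
  set D := (fibW m (m + 2)).filter (ExtK k (m + 4)) with hD
  set g : (ℕ → Site 2) → (ℕ → Site 2) := fun ω => Zd.prefixWalk (m + 2) ω with hg
  have hmemD : ∀ ω ∈ D, ω ∈ fibW m (m + 2) ∧ ExtK k (m + 4) ω := fun ω hω => Finset.mem_filter.1 hω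
  have hcoord : ∀ ω ∈ fibW m (m + 2), ω (m + 3) 0 = 2 * ω (m + 2) 0 - ω (m + 1) 0 ∧ ω (m + 3) 1 = 0 ∧
      ω (m + 4) 0 = 2 * ω (m + 3) 0 - ω (m + 2) 0 ∧ ω (m + 4) 1 = 0 := by
    intro ω hω
    obtain ⟨hωh, hm, hend, -, -, hkY, -, -⟩ := fibW_anatomy hω
    obtain ⟨hωs, -⟩ := mem_hpw.1 hωh
    obtain ⟨-, -, -, hinj⟩ := mem_saws_iff.1 hωs
    have hωa : ω ∈ archs (m + 3 + 1) := by
      rw [show m + 3 + 1 = m + 4 by omega]; exact (Finset.mem_filter.1 hω).1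
    obtain ⟨hY3, hX4⟩ := arch_last_step hωa
    obtain ⟨-, hX3⟩ := surface_next_step hωh (i := m + 2) (by omega) (by omega) hkY
    obtain ⟨hY1, hX1⟩ := surface_prev_step hωh (i := m + 1) (by omega) (by omega)
      (by rw [show m + 1 + 1 = m + 2 by omega]; exact hkY)
    rw [show m + 2 + 1 = m + 3 by omega] at hX3
    rw [show m + 1 + 1 = m + 2 by omega] at hX1
    rw [show m + 3 + 1 = m + 4 by omega] at hX4
    have hne13 : ω (m + 1) ≠ ω (m + 3) := fun h => by
      have := hinj (show m + 1 ∈ {j | j ≤ m + 4} by simp only [Set.mem_setOf_eq]; omega)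
        (show m + 3 ∈ {j | j ≤ m + 4} by simp only [Set.mem_setOf_eq]; omega) h
      omega
    have hne24 : ω (m + 2) ≠ ω (m + 4) := fun h => by
      have := hinj (show m + 2 ∈ {j | j ≤ m + 4} by simp only [Set.mem_setOf_eq]; omega)
        (show m + 4 ∈ {j | j ≤ m + 4} by simp only [Set.mem_setOf_eq]; exact le_rfl) h
      omega
    have hne13' : ω (m + 1) 0 ≠ ω (m + 3) 0 := fun h => hne13 ((site_two_eq_iff _ _).2 ⟨h, by rw [hY1, hY3]⟩)
    have hne24' : ω (m + 2) 0 ≠ ω (m + 4) 0 := fun h => hne24 ((site_two_eq_iff _ _).2 ⟨h, by rw [hkY, hend]⟩)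
    refine ⟨by omega, hY3, by omega, hend⟩
  have hprops : ∀ ω ∈ D, g ω ∈ archsK k (m + 2) ∧ visits (m + 4) ω = visits (m + 2) (g ω) + 1 := by
    intro ω hω
    obtain ⟨hωf, hE⟩ := hmemD ω hω
    obtain ⟨hωh, hm, hend, -, -, hkY, -, -⟩ := fibW_anatomy hωf
    obtain ⟨hωs, hH⟩ := mem_hpw.1 hωh
    obtain ⟨-, -, hbw, hinj⟩ := mem_saws_iff.1 hωs
    obtain ⟨hpa, hpv⟩ := prefixWalk_mem_archs hωh (show m + 2 ≤ m + 4 by omega) (by omega) hkY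
    obtain ⟨a0, a1, b0, b1⟩ := hcoord ω hωf
    refine ⟨mem_archsK.2 ⟨hpa, ?_⟩, ?_⟩
    · -- the inherited continuation: `ω (m+3)`, `ω (m+4)`, then `η 1, …, η (k-2)`
      obtain ⟨η, hη0, hadj, hηY, hηinj, hfresh⟩ := hE
      have hv : ∀ i ≤ m + 2, g ω i = ω i := fun i hi => by simp [hg, Zd.prefixWalk, min_eq_left hi]
      have hne : ∀ a b : ℕ, a ≤ m + 4 → b ≤ m + 4 → ω a = ω b → a = b := fun a b ha hb h =>
        hinj (show a ∈ {j | j ≤ m + 4} by simp only [Set.mem_setOf_eq]; exact ha)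
          (show b ∈ {j | j ≤ m + 4} by simp only [Set.mem_setOf_eq]; exact hb) h
      set θ : ℕ → Site 2 := fun i => if i < 2 then ω (m + 2 + i) else η (i - 2) with hθ
      have hθlt : ∀ i < 2, θ i = ω (m + 2 + i) := fun i hi => by simp only [hθ, if_pos hi]
      have hθge : ∀ i, 2 ≤ i → θ i = η (i - 2) := fun i hi => by simp only [hθ, if_neg (not_lt.2 hi)]
      have hθ2 : θ 2 = ω (m + 4) := by rw [hθge 2 le_rfl, show 2 - 2 = 0 from rfl, hη0]
      refine ⟨θ, by rw [hθlt 0 (by norm_num), hv _ le_rfl, add_zero], fun i hi => ?_, fun i hi1 hik => ?_, fun i hi i' hi' h => ?_,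
        fun i hi j hj1 hjk h => ?_⟩
      · rcases Nat.lt_or_ge (i + 1) 2 with h2 | h2
        · rw [hθlt i (by omega), hθlt (i + 1) h2, show m + 2 + (i + 1) = m + 2 + i + 1 by omega]
          exact hbw _ (by omega)
        · rcases Nat.lt_or_ge i 2 with h3 | h3
          · have hi1 : i = 1 := by omega
            subst hi1
            rw [hθlt 1 (by norm_num), hθ2, show m + 4 = m + 2 + 1 + 1 by omega]
            exact hbw _ (by omega)
          · rw [hθge i h3, hθge (i + 1) (by omega), show i + 1 - 2 = i - 2 + 1 by omega]; exact hadj _ (by omega)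
      · rcases Nat.lt_or_ge i 2 with h2 | h2
        · rw [hθlt i h2]; exact hH _ (by omega)
        · rcases eq_or_lt_of_le h2 with h3 | h3
          · rw [← h3, hθ2]; exact hH _ le_rfl
          · rw [hθge i h2]; exact hηY _ (by omega) (by omega)
      · -- injectivity of θ on [0,k]
        rcases Nat.lt_or_ge i 2 with h2 | h2 <;> rcases Nat.lt_or_ge i' 2 with h2' | h2'
        · rw [hθlt i h2, hθlt i' h2'] at h; have := hne _ _ (by omega) (by omega) h; omega
        · rw [hθlt i h2, hθge i' h2'] at h
          rcases eq_or_lt_of_le h2' with h3 | h3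
          · rw [← h3, show 2 - 2 = 0 from rfl, hη0] at h; have := hne _ _ (by omega) (by omega) h; omega
          · exact absurd h (hfresh _ (by omega) _ (by omega) (by omega))
        · rw [hθge i h2, hθlt i' h2'] at h
          rcases eq_or_lt_of_le h2 with h3 | h3
          · rw [← h3, show 2 - 2 = 0 from rfl, hη0] at h; have := hne _ _ (by omega) (by omega) h; omega
          · exact absurd h.symm (hfresh _ (by omega) _ (by omega) (by omega))
        · rw [hθge i h2, hθge i' h2'] at h; have := hηinj _ (by omega) _ (by omega) h; omega
      · rw [hv i hi] at h
        rcases Nat.lt_or_ge j 2 with h2 | h2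
        · rw [hθlt j h2] at h; have := hne _ _ (by omega) (by omega) h; omega
        · rcases eq_or_lt_of_le h2 with h3 | h3
          · rw [← h3, hθ2] at h; have := hne _ _ (by omega) (by omega) h; omega
          · rw [hθge j h2] at h; exact hfresh i (by omega) (j - 2) (by omega) (by omega) h
    · rw [show m + 4 = m + 3 + 1 by omega, visits_succ, show m + 3 = m + 2 + 1 by omega, visits_succ, hpv]
      have h3 : ¬ ((m + 2 + 1) % 2 = 0 ∧ ω (m + 2 + 1) 1 = 0) := fun h => by omega
      have h4 : (m + 2 + 1 + 1) % 2 = 0 ∧ ω (m + 2 + 1 + 1) 1 = 0 :=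
        ⟨by omega, by rw [show m + 2 + 1 + 1 = m + 4 by omega]; exact hend⟩
      rw [if_neg h3, if_pos h4]
  have hinj : Set.InjOn g ↑D := by
    intro ω hω ω' hω' h
    rw [Finset.mem_coe] at hω hω'
    obtain ⟨hωf, -⟩ := hmemD ω hω
    obtain ⟨hωf', -⟩ := hmemD ω' hω'
    have hc := hcoord ω hωf
    have hc' := hcoord ω' hωf'
    have hωs := hpw_subset (fibW_anatomy hωf).1
    have hωs' := hpw_subset (fibW_anatomy hωf').1
    have hagree : ∀ i ≤ m + 2, ω i = ω' i := fun i hi => by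
      have := congrFun h i
      simpa [hg, Zd.prefixWalk, min_eq_left hi] using this
    have e1 : ω (m + 1) 0 = ω' (m + 1) 0 := by rw [hagree (m + 1) (by omega)]
    have e2 : ω (m + 2) 0 = ω' (m + 2) 0 := by rw [hagree (m + 2) le_rfl]
    refine Arm.eq_of_agree hωs hωs' fun i hi => ?_
    rcases Nat.lt_or_ge i (m + 3) with hi' | hi'
    · exact hagree i (by omega)
    · rw [site_two_eq_iff]
      obtain ⟨a0, a1, b0, b1⟩ := hc
      obtain ⟨a0', a1', b0', b1'⟩ := hc'
      have hcase : i = m + 3 ∨ i = m + 4 := by omega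
      rcases hcase with rfl | rfl
      · exact ⟨by rw [a0, a0', e1, e2], by rw [a1, a1']⟩
      · exact ⟨by rw [b0, b0', a0, a0', e1, e2], by rw [b1, b1']⟩
  calc ∑ ω ∈ D, y ^ visits (m + 4) ω = ∑ ω ∈ D, y * y ^ visits (m + 2) (g ω) :=
        Finset.sum_congr rfl fun ω hω => by rw [(hprops ω hω).2, pow_succ, mul_comm]
    _ = y * ∑ ξ ∈ D.image g, y ^ visits (m + 2) ξ := by rw [Finset.mul_sum, Finset.sum_image hinj]
    _ ≤ y * XKw k (m + 2) y := by
        refine mul_le_mul_of_nonneg_left ?_ hy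
        rw [XKw]
        refine Finset.sum_le_sum_of_subset_of_nonneg (fun ξ hξ => ?_) fun _ _ _ => pow_nonneg hy _
        obtain ⟨ω, hω, rfl⟩ := Finset.mem_image.1 hξ
        exact (hprops ω hω).1

/-! ### §3  A sub-fibre of FIXED SHAPE injects into the extendable prefixes -/

open Classical in
/-- ★ **Fixed-shape injection.**  Let `S` be a set of `k`-step-extendable arches of length `j+c+4` whose last surface visit before the end is at
time `j+2`, on which the last `c+2` steps are a FIXED function of the visit `x = X_{j+2}` and the direction `σ = X_{j+2} − X_{j+1}`:
`X_{j+2+i} = x + d_i σ`, `Y_{j+2+i} = e_i` (`i ≤ c+2`).  If `k ≤ c+2` then `Σ_{S} y^{visits} ≤ y · X^{(k)}_{j+2}(y)`: the prefix map is injective on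
`S` and lands in `archsK k (j+2)` (the arch's own next `k` steps witness extendability), at the price of the one final visit.
[cite: HammersleyTorrieWhittington1982, §2 (as summarised by Beaton 2014 arXiv v3 p. 11; locator provisional); MadrasSlade1993, §1.2, (1.2.3)] -/
theorem sum_shape_le_XK {j c : ℕ} (hy : 0 ≤ y) (hkc : k ≤ c + 2) (d e : ℕ → ℤ) (S : Finset (ℕ → Site 2))
    (hS : S ⊆ (fibW (j + c) (j + 2)).filter (ExtK k (j + c + 4)))
    (hshape : ∀ ω ∈ S, ∀ i ≤ c + 2, ω (j + 2 + i) 0 = ω (j + 2) 0 + d i * (ω (j + 2) 0 - ω (j + 1) 0) ∧ ω (j + 2 + i) 1 = e i) :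
    ∑ ω ∈ S, y ^ visits (j + c + 4) ω ≤ y * XKw k (j + 2) y := by
  set g : (ℕ → Site 2) → (ℕ → Site 2) := fun ω => Zd.prefixWalk (j + 2) ω with hg
  have hmem : ∀ ω ∈ S, ω ∈ fibW (j + c) (j + 2) ∧ ExtK k (j + c + 4) ω := fun ω hω => Finset.mem_filter.1 (hS hω)
  have hprops : ∀ ω ∈ S, g ω ∈ archsK k (j + 2) ∧ visits (j + c + 4) ω = visits (j + 2) (g ω) + 1 := by
    intro ω hω
    obtain ⟨hωf, -⟩ := hmem ω hω
    obtain ⟨hωh, hm, hend, -, hk2, hkY, hno, -⟩ := fibW_anatomy hωf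
    rw [show j + c + 4 = j + c + 4 by rfl] at hend
    obtain ⟨hpa, hpv⟩ := prefixWalk_mem_archsK (k := k) hωh (show j + 2 + k ≤ j + c + 4 by omega) hk2 hkY
    refine ⟨hpa, ?_⟩
    have e1 := visits_add_eq_left (k := j + 2) (b := c + 1) (ζ := ω) (fun i hi1 hi5 h =>
      hno (j + 2 + i) (by omega) (by omega) h)
    rw [show j + c + 4 = j + 2 + (c + 1) + 1 by omega, visits_succ, e1, hpv]
    have h8 : (j + 2 + (c + 1) + 1) % 2 = 0 ∧ ω (j + 2 + (c + 1) + 1) 1 = 0 :=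
      ⟨by omega, by rw [show j + 2 + (c + 1) + 1 = j + c + 4 by omega]; exact hend⟩
    rw [if_pos h8]
  have hinj : Set.InjOn g ↑S := by
    intro ω hω ω' hω' h
    rw [Finset.mem_coe] at hω hω'
    have hc := hshape ω hω
    have hc' := hshape ω' hω'
    have hωs : ω ∈ saws (j + c + 4) := hpw_subset (fibW_anatomy (hmem ω hω).1).1
    have hωs' : ω' ∈ saws (j + c + 4) := hpw_subset (fibW_anatomy (hmem ω' hω').1).1
    have hagree : ∀ i ≤ j + 2, ω i = ω' i := fun i hi => by
      have := congrFun h i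
      simpa [hg, Zd.prefixWalk, min_eq_left hi] using this
    have e1 : ω (j + 1) 0 = ω' (j + 1) 0 := by rw [hagree (j + 1) (by omega)]
    have e2 : ω (j + 2) 0 = ω' (j + 2) 0 := by rw [hagree (j + 2) le_rfl]
    refine Arm.eq_of_agree hωs hωs' fun i hi => ?_
    rcases Nat.lt_or_ge i (j + 3) with hi' | hi'
    · exact hagree i (by omega)
    · obtain ⟨i', rfl⟩ : ∃ i', i = j + 2 + i' := ⟨i - (j + 2), by omega⟩
      obtain ⟨a0, a1⟩ := hc i' (by omega)
      obtain ⟨a0', a1'⟩ := hc' i' (by omega)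
      rw [site_two_eq_iff]
      exact ⟨by rw [a0, a0', e1, e2], by rw [a1, a1']⟩
  calc ∑ ω ∈ S, y ^ visits (j + c + 4) ω = ∑ ω ∈ S, y * y ^ visits (j + 2) (g ω) :=
        Finset.sum_congr rfl fun ω hω => by rw [(hprops ω hω).2, pow_succ, mul_comm]
    _ = y * ∑ ξ ∈ S.image g, y ^ visits (j + 2) ξ := by rw [Finset.mul_sum, Finset.sum_image hinj]
    _ ≤ y * XKw k (j + 2) y := by
        refine mul_le_mul_of_nonneg_left ?_ hy
        rw [XKw]
        refine Finset.sum_le_sum_of_subset_of_nonneg (fun ξ hξ => ?_) fun _ _ _ => pow_nonneg hy _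
        obtain ⟨ω, hω, rfl⟩ := Finset.mem_image.1 hξ
        exact (hprops ω hω).1

/-! ### §4  The dip fibre under `k`-step extendability (`k ≥ 1`) -/

/-- Shape table of the forward dip: `X_{j+2+i} = x + d_i σ`. [cite: EntingJensen2009, §7.4.2, Fig. 7.10] -/
def dipD : ℕ → ℤ
  | 0 => 0 | 1 => 1 | 2 => 1 | 3 => 2 | 4 => 3 | 5 => 3 | _ => 4

/-- Shape table of the forward dip: `Y_{j+2+i} = e_i`. [cite: EntingJensen2009, §7.4.2, Fig. 7.10] -/
def dipE : ℕ → ℤ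
  | 2 => -1 | 3 => -1 | 4 => -1 | _ => 0

open Classical in
/-- **The dip fibre under `k`-step extendability** (`k ≥ 1`): `Σ_{fibW (j+4) (j+2) ∩ ExtK k} y^{visits} ≤ y · X^{(k)}_{j+2}(y)` — by the
parent's `dip_coords` (an extendable arch six steps after its last visit ends with the forward dip) and the fixed-shape injection.
[cite: EntingJensen2009, §7.4.2, Fig. 7.10; HammersleyTorrieWhittington1982, §2] -/
theorem sum_fibW_dip_le_XK (j : ℕ) (hy : 0 ≤ y) (hk1 : 1 ≤ k) (hk6 : k ≤ 6) :
    ∑ ω ∈ (fibW (j + 4) (j + 2)).filter (ExtK k (j + 8)), y ^ visits (j + 8) ω ≤ y * XKw k (j + 2) y := by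
  refine sum_shape_le_XK (c := 4) hy (by omega) dipD dipE _ (fun ω hω => hω) fun ω hω i hi => ?_
  obtain ⟨hωf, hE⟩ := Finset.mem_filter.1 hω
  have hωa : ω ∈ archs (j + 8) := by
    have := (Finset.mem_filter.1 hωf).1; rwa [show j + 4 + 4 = j + 8 by omega] at this
  obtain ⟨-, ⟨a0, a1⟩, ⟨b0, b1⟩, ⟨c0, c1⟩, ⟨d0, d1⟩, ⟨f0, f1⟩, ⟨g0, g1⟩⟩ := dip_coords hωf (hE.extRow hωa hk1)
  obtain ⟨-, -, -, -, -, hkY, -, -⟩ := fibW_anatomy hωf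
  have hcase : i = 0 ∨ i = 1 ∨ i = 2 ∨ i = 3 ∨ i = 4 ∨ i = 5 ∨ i = 6 := by omega
  rcases hcase with rfl | rfl | rfl | rfl | rfl | rfl | rfl
  · exact ⟨by simp [dipD], by simpa [dipE] using hkY⟩
  · exact ⟨by rw [a0]; simp [dipD]; ring, by simpa [dipE] using a1⟩
  · exact ⟨by rw [b0]; simp [dipD]; ring, by simpa [dipE] using b1⟩
  · exact ⟨by rw [c0]; simp [dipD]; ring, by simpa [dipE] using c1⟩
  · exact ⟨by rw [d0]; simp [dipD]; ring, by simpa [dipE] using d1⟩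
  · exact ⟨by rw [f0]; simp [dipD]; ring, by simpa [dipE] using f1⟩
  · exact ⟨by rw [g0]; simp [dipD]; ring, by simpa [dipE] using g1⟩

/-- Shape table of the forward flat excursion of length eight: `X_{j+2+i} = x + d_i σ`. [cite: EntingJensen2009, §7.4.2, Fig. 7.10] -/
def flatD : ℕ → ℤ
  | 0 => 0 | 1 => 1 | 2 => 1 | 3 => 2 | 4 => 3 | 5 => 4 | 6 => 5 | 7 => 5 | _ => 6

/-- Shape table of the forward flat excursion: `Y_{j+2+i} = e_i`. [cite: EntingJensen2009, §7.4.2, Fig. 7.10] -/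
def flatE : ℕ → ℤ
  | 2 => -1 | 3 => -1 | 4 => -1 | 5 => -1 | 6 => -1 | _ => 0

/-! ### §5  Unpacking extendability: the first one / three / five fresh steps -/

/-- Three fresh steps from a `k`-step extension (`k ≥ 3`), in the parent's `Ext3` format plus no immediate reversals.
[cite: HammersleyTorrieWhittington1982, §2; MadrasSlade1993, §1.2, (1.2.3)] -/
theorem ExtK.three (hE : ExtK k n ω) (hk : 3 ≤ k) :
    ∃ z₁ z₂ z₃ : Site 2, brickWallGraph.Adj (ω n) z₁ ∧ brickWallGraph.Adj z₁ z₂ ∧ brickWallGraph.Adj z₂ z₃ ∧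
      z₁ 1 ≤ 0 ∧ z₂ 1 ≤ 0 ∧ z₃ 1 ≤ 0 ∧ z₂ ≠ ω n ∧ z₁ ≠ z₃ ∧ ∀ i ≤ n, ω i ≠ z₁ ∧ ω i ≠ z₂ ∧ ω i ≠ z₃ := by
  obtain ⟨η, h0, hadj, hY, hinj, hfresh⟩ := hE
  refine ⟨η 1, η 2, η 3, by rw [← h0]; exact hadj 0 (by omega), hadj 1 (by omega), hadj 2 (by omega),
    hY 1 le_rfl (by omega), hY 2 (by norm_num) (by omega), hY 3 (by norm_num) (by omega), fun h => ?_, fun h => ?_,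
    fun i hi => ⟨hfresh i hi 1 le_rfl (by omega), hfresh i hi 2 (by norm_num) (by omega), hfresh i hi 3 (by norm_num) (by omega)⟩⟩
  · have := hinj 2 (by omega) 0 (by omega) (by rw [h, h0]); omega
  · have := hinj 1 (by omega) 3 (by omega) h; omega

/-- Five fresh steps from a `k`-step extension (`k ≥ 5`), with no immediate reversals.
[cite: HammersleyTorrieWhittington1982, §2; MadrasSlade1993, §1.2, (1.2.3)] -/
theorem ExtK.five (hE : ExtK k n ω) (hk : 5 ≤ k) :
    ∃ z₁ z₂ z₃ z₄ z₅ : Site 2, brickWallGraph.Adj (ω n) z₁ ∧ brickWallGraph.Adj z₁ z₂ ∧ brickWallGraph.Adj z₂ z₃ ∧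
      brickWallGraph.Adj z₃ z₄ ∧ brickWallGraph.Adj z₄ z₅ ∧ z₁ 1 ≤ 0 ∧ z₂ 1 ≤ 0 ∧ z₃ 1 ≤ 0 ∧ z₄ 1 ≤ 0 ∧ z₅ 1 ≤ 0 ∧
      z₂ ≠ ω n ∧ z₁ ≠ z₃ ∧ z₂ ≠ z₄ ∧ z₃ ≠ z₅ ∧
      ∀ i ≤ n, ω i ≠ z₁ ∧ ω i ≠ z₂ ∧ ω i ≠ z₃ ∧ ω i ≠ z₄ ∧ ω i ≠ z₅ := by
  obtain ⟨η, h0, hadj, hY, hinj, hfresh⟩ := hE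
  refine ⟨η 1, η 2, η 3, η 4, η 5, by rw [← h0]; exact hadj 0 (by omega), hadj 1 (by omega), hadj 2 (by omega), hadj 3 (by omega),
    hadj 4 (by omega), hY 1 le_rfl (by omega), hY 2 (by norm_num) (by omega), hY 3 (by norm_num) (by omega),
    hY 4 (by norm_num) (by omega), hY 5 (by norm_num) (by omega), fun h => ?_, fun h => ?_, fun h => ?_, fun h => ?_,
    fun i hi => ⟨hfresh i hi 1 le_rfl (by omega), hfresh i hi 2 (by norm_num) (by omega), hfresh i hi 3 (by norm_num) (by omega),
      hfresh i hi 4 (by norm_num) (by omega), hfresh i hi 5 (by norm_num) (by omega)⟩⟩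
  · have := hinj 2 (by omega) 0 (by omega) (by rw [h, h0]); omega
  · have := hinj 1 (by omega) 3 (by omega) h; omega
  · have := hinj 2 (by omega) 4 (by omega) h; omega
  · have := hinj 3 (by omega) 5 (by omega) h; omega

/-! ### §6  The flat fibre (excursion length eight) under `k`-step extendability, `k ≥ 3` -/

set_option maxHeartbeats 400000 in
open Classical in
/-- ★★ **The flat fibre under extendability** (`j ≥ 1`, `k ≥ 3`): for `ω ∈ fibW (j+6) (j+2)` (last surface visit `ω (j+2) = (x,0)` eight steps
before the end; `x' = X_{j+1}`, `σ = x − x'`) with a fresh `k`-step continuation, the last eight steps are the FLAT excursion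
`(x+σ,0) (x+σ,−1) (x+2σ,−1) (x+3σ,−1) (x+4σ,−1) (x+5σ,−1) (x+5σ,0) (x+6σ,0)`: the walk cannot turn back under its start (it would meet
`ω j = (x−σ,−1)`, or be forced along `(x−2σ,−1) (x−3σ,−1)` to resurface at `ω (j−1) = (x−3σ,0)`), cannot drop to depth `−2` (no
resurfacing by time `j+9`), and the «late hook» ending `(x+5σ,0) → (x+4σ,0)` admits exactly the two fresh steps `(x+3σ,0) (x+2σ,0)` and no
third.  (Re-derived under the present hypothesis; the lane's third-order car proves the same conclusion under its own three-step
extendability predicate.) [cite: EntingJensen2009, §7.4.2, Fig. 7.10 (brickwork form of the honeycomb lattice); BeatonBousquetMelouDeGierDuminilCopinGuttmann2014, §3.1 (arXiv v5 p. 9)] -/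
theorem flat8_coordsK {j : ℕ} (hj : 1 ≤ j) (hω : ω ∈ fibW (j + 6) (j + 2)) (hE : ExtK k (j + 10) ω) (hk : 3 ≤ k) :
    ∀ i ≤ 8, ω (j + 2 + i) 0 = ω (j + 2) 0 + flatD i * (ω (j + 2) 0 - ω (j + 1) 0) ∧ ω (j + 2 + i) 1 = flatE i := by
  have hω' : ω ∈ fibW (j + 6) (j + 2) := hω
  obtain ⟨hωh, -, hend, -, hk2, hkY, hno, -⟩ := fibW_anatomy hω'
  rw [show j + 6 + 4 = j + 10 by omega] at hωh hend
  obtain ⟨hωs, hH⟩ := mem_hpw.1 hωh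
  obtain ⟨-, -, hbw, hinj⟩ := mem_saws_iff.1 hωs
  have hne : ∀ a b : ℕ, a ≤ j + 10 → b ≤ j + 10 → a ≠ b → ¬ (ω a 0 = ω b 0 ∧ ω a 1 = ω b 1) := by
    intro a b ha hb hab h
    have := hinj (show a ∈ {i | i ≤ j + 10} by simp only [Set.mem_setOf_eq]; exact ha)
      (show b ∈ {i | i ≤ j + 10} by simp only [Set.mem_setOf_eq]; exact hb) ((site_two_eq_iff _ _).2 h)
    exact hab this
  have hparx : (ω (j + 2) 0 + ω (j + 2) 1) % 2 = ((j + 2 : ℕ) : ℤ) % 2 := parity_apply hωs (i := j + 2) (by omega)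
  have hxe : ω (j + 2) 0 % 2 = 0 := by rw [hkY, add_zero] at hparx; push_cast at hparx; omega
  obtain ⟨hY1, hX2⟩ := surface_prev_step hωh (i := j + 1) (by omega) (by omega)
    (by rw [show j + 1 + 1 = j + 2 by omega]; exact hkY)
  rw [show j + 1 + 1 = j + 2 by omega] at hX2
  -- `ω j`: either the surface vertex `(x−2σ,0)` (then `ω (j−1) = (x−3σ,0)`) or `(x−σ,−1)`
  have h_prev : (ω j 1 = 0 ∧ ω j 0 = 2 * ω (j + 1) 0 - ω (j + 2) 0 ∧ ω (j - 1) 1 = 0 ∧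
      ω (j - 1) 0 = 3 * ω (j + 1) 0 - 2 * ω (j + 2) 0) ∨ (ω j 1 = -1 ∧ ω j 0 = ω (j + 1) 0) := by
    have sj := Arm.step_cases (hbw j (by omega))
    have hHj := hH j (by omega)
    have h02 := hne j (j + 2) (by omega) (by omega) (by omega)
    by_cases hYj : ω j 1 = 0
    · left
      have hev : j % 2 = 0 := by omega
      obtain ⟨hY0, hX0⟩ := surface_prev_step hωh (i := j - 1) (by omega) (by rw [show j - 1 + 1 = j by omega]; exact hev)
        (by rw [show j - 1 + 1 = j by omega]; exact hYj)
      rw [show j - 1 + 1 = j by omega] at hX0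
      have hm11 := hne (j - 1) (j + 1) (by omega) (by omega) (by omega)
      have hXj : ω j 0 = 2 * ω (j + 1) 0 - ω (j + 2) 0 := by clear hX0 hm11; omega
      refine ⟨hYj, hXj, hY0, ?_⟩
      clear sj h02
      omega
    · right
      constructor <;> omega
  -- forward: `ω (j+3) = (x+σ, 0)`
  obtain ⟨hY3, hX3⟩ := surface_next_step hωh (i := j + 2) (by omega) hk2 hkY
  rw [show j + 2 + 1 = j + 3 by omega] at hY3 hX3
  have h31 := hne (j + 3) (j + 1) (by omega) (by omega) (by omega)
  have hX3' : ω (j + 3) 0 = 2 * ω (j + 2) 0 - ω (j + 1) 0 := by clear h_prev; omega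
  clear hX3 h31
  -- `ω (j+4) = (x+σ, −1)`
  have hn4 : ¬ (ω (j + 4) 1 = 0) := fun h => hno (j + 4) (by omega) (by omega) ⟨by omega, h⟩
  have s4 := Arm.step_cases (hbw (j + 3) (by omega))
  rw [show j + 3 + 1 = j + 4 by omega] at s4
  have hH4 := hH (j + 4) (by omega)
  have hXY4 : ω (j + 4) 0 = ω (j + 3) 0 ∧ ω (j + 4) 1 = -1 := by clear h_prev; constructor <;> omega
  obtain ⟨hX4, hY4⟩ := hXY4
  clear s4 hn4 hH4
  -- `ω (j+5)`: along depth `−1`, `X ∈ {x, x+2σ}`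
  have s5 := Arm.step_cases (hbw (j + 4) (by omega))
  rw [show j + 4 + 1 = j + 5 by omega] at s5
  have h53 := hne (j + 5) (j + 3) (by omega) (by omega) (by omega)
  have hY5 : ω (j + 5) 1 = -1 := by clear h_prev; omega
  have hX5 : ω (j + 5) 0 = ω (j + 4) 0 + 1 ∨ ω (j + 4) 0 = ω (j + 5) 0 + 1 := by clear h_prev; omega
  clear s5 h53
  have s6 := Arm.step_cases (hbw (j + 5) (by omega))
  rw [show j + 5 + 1 = j + 6 by omega] at s6
  have s7 := Arm.step_cases (hbw (j + 6) (by omega))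
  rw [show j + 6 + 1 = j + 7 by omega] at s7
  have s8 := Arm.step_cases (hbw (j + 7) (by omega))
  rw [show j + 7 + 1 = j + 8 by omega] at s8
  have s9 := Arm.step_cases (hbw (j + 8) (by omega))
  rw [show j + 8 + 1 = j + 9 by omega] at s9
  obtain ⟨hY9, hX10⟩ : ω (j + 9) 1 = 0 ∧ (ω (j + 9 + 1) 0 = ω (j + 9) 0 + 1 ∨ ω (j + 9) 0 = ω (j + 9 + 1) 0 + 1) :=
    arch_last_step (n := j + 9) (by rw [show j + 9 + 1 = j + 6 + 4 by omega]; exact (Finset.mem_filter.1 hω').1)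
  rw [show j + 9 + 1 = j + 10 by omega] at hX10
  have h75 := hne (j + 7) (j + 5) (by omega) (by omega) (by omega)
  have hn6 : ¬ (ω (j + 6) 1 = 0) := fun h => hno (j + 6) (by omega) (by omega) ⟨by omega, h⟩
  have hY6 : ω (j + 6) 1 = -1 := by
    clear h_prev hX2 hX3' hX5 hX4 hxe hX10
    omega
  have hX6 : ω (j + 6) 0 = ω (j + 5) 0 + 1 ∨ ω (j + 5) 0 = ω (j + 6) 0 + 1 := by
    clear h_prev s7 s8 s9 h75 hX2 hxe hX10
    omega
  have h64 := hne (j + 6) (j + 4) (by omega) (by omega) (by omega)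
  clear s6
  -- exclude the backward branch `X_{j+5} = x`
  have hfwd : ω (j + 5) 0 = 3 * ω (j + 2) 0 - 2 * ω (j + 1) 0 := by
    by_contra hb
    have hX5' : ω (j + 5) 0 = ω (j + 2) 0 := by
      clear h_prev s7 s8 s9 h75 hX6 h64 hxe hX10
      omega
    have hX6' : ω (j + 6) 0 = ω (j + 1) 0 := by
      clear h_prev s7 s8 s9 h75 hxe hb hX10
      omega
    clear hX5 hX6 h64 hb
    have h60 := hne (j + 6) j (by omega) (by omega) (by omega)
    rcases h_prev with ⟨hYj, hXj, hY0, hX0⟩ | ⟨hYj, hXj⟩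
    · have h71 := hne (j + 7) (j + 1) (by omega) (by omega) (by omega)
      have hXY7 : ω (j + 7) 0 = 2 * ω (j + 1) 0 - ω (j + 2) 0 ∧ ω (j + 7) 1 = -1 := by
        clear s8 s9 hY0 hX0 h60 hYj hXj hX10
        constructor <;> omega
      obtain ⟨hX7, hY7⟩ := hXY7
      clear s7 h71 h75
      have h86 := hne (j + 8) (j + 6) (by omega) (by omega) (by omega)
      have h80 := hne (j + 8) j (by omega) (by omega) (by omega)
      have hn8 : ¬ (ω (j + 8) 1 = 0) := fun h => hno (j + 8) (by omega) (by omega) ⟨by omega, h⟩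
      have hXY8 : ω (j + 8) 0 = 3 * ω (j + 1) 0 - 2 * ω (j + 2) 0 ∧ ω (j + 8) 1 = -1 := by
        clear hY0 hX0 h60 hX10
        constructor <;> omega
      obtain ⟨hX8, hY8⟩ := hXY8
      clear s8 h86 h80 hn8
      have h9m := hne (j + 9) (j - 1) (by omega) (by omega) (by omega)
      clear hX10
      omega
    · exact h60 ⟨by omega, by omega⟩
  have hX6' : ω (j + 6) 0 = 4 * ω (j + 2) 0 - 3 * ω (j + 1) 0 := by
    clear s7 s8 s9 h_prev h75 hxe hX10
    omega
  clear hX5 hX6 h64 h_prev s7 s8 s9 hY9 hX10 h75 hn6 hparx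
  -- the tail: `(x+4σ,−1) (x+5σ,−1) (x+5σ,0)` and the end (fresh step facts, small context)
  have s7 := Arm.step_cases (hbw (j + 6) (by omega))
  rw [show j + 6 + 1 = j + 7 by omega] at s7
  have s8 := Arm.step_cases (hbw (j + 7) (by omega))
  rw [show j + 7 + 1 = j + 8 by omega] at s8
  have s9 := Arm.step_cases (hbw (j + 8) (by omega))
  rw [show j + 8 + 1 = j + 9 by omega] at s9
  obtain ⟨hY9, hX10⟩ : ω (j + 9) 1 = 0 ∧ (ω (j + 9 + 1) 0 = ω (j + 9) 0 + 1 ∨ ω (j + 9) 0 = ω (j + 9 + 1) 0 + 1) :=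
    arch_last_step (n := j + 9) (by rw [show j + 9 + 1 = j + 6 + 4 by omega]; exact (Finset.mem_filter.1 hω').1)
  rw [show j + 9 + 1 = j + 10 by omega] at hX10
  have h75 := hne (j + 7) (j + 5) (by omega) (by omega) (by omega)
  have hH7 := hH (j + 7) (by omega)
  have hH8 := hH (j + 8) (by omega)
  have hn8 : ¬ (ω (j + 8) 1 = 0) := fun h => hno (j + 8) (by omega) (by omega) ⟨by omega, h⟩
  have h86 := hne (j + 8) (j + 6) (by omega) (by omega) (by omega)
  have hXY7 : ω (j + 7) 1 = -1 ∧ ω (j + 7) 0 = 5 * ω (j + 2) 0 - 4 * ω (j + 1) 0 := by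
    clear hX10 s9 hY9
    constructor <;> omega
  obtain ⟨hY7, hX7⟩ := hXY7
  clear s7 h75
  have hXY8 : ω (j + 8) 1 = -1 ∧ ω (j + 8) 0 = 6 * ω (j + 2) 0 - 5 * ω (j + 1) 0 := by
    clear hX10 hX3' hX4 hfwd
    constructor <;> omega
  obtain ⟨hY8, hX8⟩ := hXY8
  clear s8 h86 hn8
  have hX9 : ω (j + 9) 0 = ω (j + 8) 0 := by
    clear hX10 hX3' hX4 hfwd hX6' hX7
    omega
  clear s9
  -- the end: the late hook `(x+4σ,0)` is not three-step extendable
  have hX10' : ω (j + 10) 0 = 7 * ω (j + 2) 0 - 6 * ω (j + 1) 0 := by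
    by_contra h10
    have hhook : ω (j + 10) 0 = 5 * ω (j + 2) 0 - 4 * ω (j + 1) 0 := by omega
    clear hX10 h10
    obtain ⟨z₁, z₂, z₃, hz1, hz2, hz3, hz1', hz2', hz3', -, hz13, hfresh⟩ := hE.three hk
    rw [brickWallGraph_adj_coord] at hz1 hz2 hz3
    have hpar := parity_apply hωs (i := j + 10) le_rfl
    rw [hend] at hpar
    push_cast at hpar
    -- `z₁ = (x+3σ, 0)`
    obtain ⟨f9a, -, -⟩ := hfresh (j + 9) (by omega)
    have a9 : ¬ (ω (j + 9) 0 = z₁ 0 ∧ ω (j + 9) 1 = z₁ 1) := fun h => f9a ((site_two_eq_iff _ _).2 h)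
    have hz1c : z₁ 0 = 4 * ω (j + 2) 0 - 3 * ω (j + 1) 0 ∧ z₁ 1 = 0 := by
      clear hz2 hz3 hz2' hz3' hz13 hX3' hX4 hfwd hX6' hX7
      constructor <;> omega
    obtain ⟨hz1x, hz1y⟩ := hz1c
    clear hz1 a9 f9a
    -- `z₂ = (x+2σ, 0)`
    obtain ⟨-, f10b, -⟩ := hfresh (j + 10) (by omega)
    obtain ⟨-, f6b, -⟩ := hfresh (j + 6) (by omega)
    have b10 : ¬ (ω (j + 10) 0 = z₂ 0 ∧ ω (j + 10) 1 = z₂ 1) := fun h => f10b ((site_two_eq_iff _ _).2 h)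
    have b6 : ¬ (ω (j + 6) 0 = z₂ 0 ∧ ω (j + 6) 1 = z₂ 1) := fun h => f6b ((site_two_eq_iff _ _).2 h)
    have hz2c : z₂ 0 = 3 * ω (j + 2) 0 - 2 * ω (j + 1) 0 ∧ z₂ 1 = 0 := by
      clear hz3 hz3' hz13 hX3' hX4 hfwd hX7 hX8 hX9
      constructor <;> omega
    obtain ⟨hz2x, hz2y⟩ := hz2c
    clear hz2 b10 b6 f10b f6b
    -- no `z₃`
    obtain ⟨-, -, f3c⟩ := hfresh (j + 3) (by omega)
    have c3 : ¬ (ω (j + 3) 0 = z₃ 0 ∧ ω (j + 3) 1 = z₃ 1) := fun h => f3c ((site_two_eq_iff _ _).2 h)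
    have d13 : ¬ (z₁ 0 = z₃ 0 ∧ z₁ 1 = z₃ 1) := fun h => hz13 ((site_two_eq_iff _ _).2 h)
    clear hX4 hfwd hX6' hX7 hX8 hX9 hfresh hz13 f3c
    omega
  clear hX10
  -- assemble the table
  intro i hi
  have hcase : i = 0 ∨ i = 1 ∨ i = 2 ∨ i = 3 ∨ i = 4 ∨ i = 5 ∨ i = 6 ∨ i = 7 ∨ i = 8 := by omega
  rcases hcase with rfl | rfl | rfl | rfl | rfl | rfl | rfl | rfl | rfl
  · exact ⟨by simp [flatD], by simpa [flatE] using hkY⟩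
  · refine ⟨?_, by simpa [flatE] using hY3⟩; rw [show j + 2 + 1 = j + 3 by omega, hX3']; simp [flatD]; ring
  · refine ⟨?_, by simpa [flatE] using hY4⟩; rw [show j + 2 + 2 = j + 4 by omega, hX4, hX3']; simp [flatD]; ring
  · refine ⟨?_, by simpa [flatE] using hY5⟩; rw [show j + 2 + 3 = j + 5 by omega, hfwd]; simp [flatD]; ring
  · refine ⟨?_, by simpa [flatE] using hY6⟩; rw [show j + 2 + 4 = j + 6 by omega, hX6']; simp [flatD]; ring
  · refine ⟨?_, by simpa [flatE] using hY7⟩; rw [show j + 2 + 5 = j + 7 by omega, hX7]; simp [flatD]; ring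
  · refine ⟨?_, by simpa [flatE] using hY8⟩; rw [show j + 2 + 6 = j + 8 by omega, hX8]; simp [flatD]; ring
  · refine ⟨?_, by simpa [flatE] using hY9⟩; rw [show j + 2 + 7 = j + 9 by omega, hX9, hX8]; simp [flatD]; ring
  · refine ⟨?_, by simpa [flatE] using hend⟩; rw [show j + 2 + 8 = j + 10 by omega, hX10']; simp [flatD]; ring

open Classical in
/-- **The flat fibre under `k`-step extendability** (`j ≥ 1`, `3 ≤ k ≤ 8`): `Σ_{fibW (j+6) (j+2) ∩ ExtK k} y^{visits} ≤ y · X^{(k)}_{j+2}(y)`.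
[cite: HammersleyTorrieWhittington1982, §2 (as summarised by Beaton 2014 arXiv v3 p. 11; locator provisional); EntingJensen2009, §7.4.2, Fig. 7.10] -/
theorem sum_fibW_flat8_le_XK {j : ℕ} (hj : 1 ≤ j) (hy : 0 ≤ y) (hk3 : 3 ≤ k) (hk8 : k ≤ 8) :
    ∑ ω ∈ (fibW (j + 6) (j + 2)).filter (ExtK k (j + 10)), y ^ visits (j + 10) ω ≤ y * XKw k (j + 2) y := by
  refine sum_shape_le_XK (c := 6) hy (by omega) flatD flatE _ (fun ω hω => hω) fun ω hω i hi => ?_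
  obtain ⟨hωf, hE⟩ := Finset.mem_filter.1 hω
  exact flat8_coordsK hj hωf hE hk3 i hi

/-! ### §7  The fibre of excursion length TEN -/

set_option maxHeartbeats 400000 in
/-- **Frame of the ten-fibre** (`j ≥ 4`, no extendability): for `ω ∈ fibW (j+8) (j+2)` (an arch of length `j+12` whose last surface visit before
the end is `ω (j+2) = (x,0)`, `x' = X_{j+1}`, `σ = x − x'`): the history `ω (j+1) = (x−σ,0)`; either `ω j = (x−2σ,0)`, `ω (j−1) = (x−3σ,0)` and
(`ω (j−2) = (x−4σ,0)`, `ω (j−3) = (x−5σ,0)`, or `ω (j−2) = (x−3σ,−1)`), or `ω j = (x−σ,−1)` with `ω (j−1) ∈ {(x−2σ,−1), (x,−1), (x−σ,−2)}`;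
and the first three steps of the excursion: `(x+σ,0) (x+σ,−1)`, then `(x+2σ,−1)` or `(x,−1)`. [cite: EntingJensen2009, §7.4.2, Fig. 7.10 (brickwork form of the honeycomb lattice)] -/
theorem ten_frame {j : ℕ} (hj : 4 ≤ j) (hω : ω ∈ fibW (j + 8) (j + 2)) :
    ω (j + 1) 1 = 0 ∧ (ω (j + 2) 0 = ω (j + 1) 0 + 1 ∨ ω (j + 1) 0 = ω (j + 2) 0 + 1) ∧ ω (j + 2) 0 % 2 = 0 ∧
    ((ω j 1 = 0 ∧ ω j 0 = 2 * ω (j + 1) 0 - ω (j + 2) 0 ∧ ω (j - 1) 1 = 0 ∧ ω (j - 1) 0 = 3 * ω (j + 1) 0 - 2 * ω (j + 2) 0 ∧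
        ((ω (j - 2) 1 = 0 ∧ ω (j - 2) 0 = 4 * ω (j + 1) 0 - 3 * ω (j + 2) 0 ∧ ω (j - 3) 1 = 0 ∧
            ω (j - 3) 0 = 5 * ω (j + 1) 0 - 4 * ω (j + 2) 0) ∨
          (ω (j - 2) 1 = -1 ∧ ω (j - 2) 0 = 3 * ω (j + 1) 0 - 2 * ω (j + 2) 0))) ∨
      (ω j 1 = -1 ∧ ω j 0 = ω (j + 1) 0 ∧
        ((ω (j - 1) 1 = -1 ∧ ω (j - 1) 0 = 2 * ω (j + 1) 0 - ω (j + 2) 0) ∨ (ω (j - 1) 1 = -1 ∧ ω (j - 1) 0 = ω (j + 2) 0) ∨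
          (ω (j - 1) 1 = -2 ∧ ω (j - 1) 0 = ω (j + 1) 0)))) ∧
    (ω (j + 3) 0 = 2 * ω (j + 2) 0 - ω (j + 1) 0 ∧ ω (j + 3) 1 = 0) ∧
    (ω (j + 4) 0 = 2 * ω (j + 2) 0 - ω (j + 1) 0 ∧ ω (j + 4) 1 = -1) ∧
    (ω (j + 5) 1 = -1 ∧ (ω (j + 5) 0 = 3 * ω (j + 2) 0 - 2 * ω (j + 1) 0 ∨ ω (j + 5) 0 = ω (j + 2) 0)) := by
  have hω' : ω ∈ fibW (j + 8) (j + 2) := hω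
  obtain ⟨hωh, -, hend, -, hk2, hkY, hno, -⟩ := fibW_anatomy hω'
  rw [show j + 8 + 4 = j + 12 by omega] at hωh hend
  obtain ⟨hωs, hH⟩ := mem_hpw.1 hωh
  obtain ⟨-, -, hbw, hinj⟩ := mem_saws_iff.1 hωs
  have hne : ∀ a b : ℕ, a ≤ j + 12 → b ≤ j + 12 → a ≠ b → ¬ (ω a 0 = ω b 0 ∧ ω a 1 = ω b 1) := by
    intro a b ha hb hab h
    have := hinj (show a ∈ {i | i ≤ j + 12} by simp only [Set.mem_setOf_eq]; exact ha)
      (show b ∈ {i | i ≤ j + 12} by simp only [Set.mem_setOf_eq]; exact hb) ((site_two_eq_iff _ _).2 h)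
    exact hab this
  have hparx : (ω (j + 2) 0 + ω (j + 2) 1) % 2 = ((j + 2 : ℕ) : ℤ) % 2 := parity_apply hωs (i := j + 2) (by omega)
  have hxe : ω (j + 2) 0 % 2 = 0 := by rw [hkY, add_zero] at hparx; push_cast at hparx; omega
  clear hparx
  obtain ⟨hY1, hX2⟩ := surface_prev_step hωh (i := j + 1) (by omega) (by omega)
    (by rw [show j + 1 + 1 = j + 2 by omega]; exact hkY)
  rw [show j + 1 + 1 = j + 2 by omega] at hX2
  -- history
  have h_prev : (ω j 1 = 0 ∧ ω j 0 = 2 * ω (j + 1) 0 - ω (j + 2) 0 ∧ ω (j - 1) 1 = 0 ∧ ω (j - 1) 0 = 3 * ω (j + 1) 0 - 2 * ω (j + 2) 0 ∧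
        ((ω (j - 2) 1 = 0 ∧ ω (j - 2) 0 = 4 * ω (j + 1) 0 - 3 * ω (j + 2) 0 ∧ ω (j - 3) 1 = 0 ∧
            ω (j - 3) 0 = 5 * ω (j + 1) 0 - 4 * ω (j + 2) 0) ∨
          (ω (j - 2) 1 = -1 ∧ ω (j - 2) 0 = 3 * ω (j + 1) 0 - 2 * ω (j + 2) 0))) ∨
      (ω j 1 = -1 ∧ ω j 0 = ω (j + 1) 0 ∧
        ((ω (j - 1) 1 = -1 ∧ ω (j - 1) 0 = 2 * ω (j + 1) 0 - ω (j + 2) 0) ∨ (ω (j - 1) 1 = -1 ∧ ω (j - 1) 0 = ω (j + 2) 0) ∨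
          (ω (j - 1) 1 = -2 ∧ ω (j - 1) 0 = ω (j + 1) 0))) := by
    have sj := Arm.step_cases (hbw j (by omega))
    have hHj := hH j (by omega)
    have h02 := hne j (j + 2) (by omega) (by omega) (by omega)
    by_cases hYj : ω j 1 = 0
    · left
      have hev : j % 2 = 0 := by omega
      obtain ⟨hY0, hX0⟩ := surface_prev_step hωh (i := j - 1) (by omega) (by rw [show j - 1 + 1 = j by omega]; exact hev)
        (by rw [show j - 1 + 1 = j by omega]; exact hYj)
      rw [show j - 1 + 1 = j by omega] at hX0
      have hm11 := hne (j - 1) (j + 1) (by omega) (by omega) (by omega)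
      have hXj : ω j 0 = 2 * ω (j + 1) 0 - ω (j + 2) 0 := by clear hX0 hm11; omega
      have hXm1 : ω (j - 1) 0 = 3 * ω (j + 1) 0 - 2 * ω (j + 2) 0 := by clear sj h02; omega
      clear sj hHj h02 hX0 hm11
      refine ⟨hYj, hXj, hY0, hXm1, ?_⟩
      -- two more steps back
      have sm2 := Arm.step_cases (hbw (j - 2) (by omega))
      rw [show j - 2 + 1 = j - 1 by omega] at sm2
      have hHm2 := hH (j - 2) (by omega)
      have hm20 := hne (j - 2) j (by omega) (by omega) (by omega)
      by_cases hYm2 : ω (j - 2) 1 = 0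
      · left
        have hev2 : (j - 2) % 2 = 0 := by omega
        obtain ⟨hYm3, hXm3⟩ := surface_prev_step hωh (i := j - 3) (by omega) (by rw [show j - 3 + 1 = j - 2 by omega]; exact hev2)
          (by rw [show j - 3 + 1 = j - 2 by omega]; exact hYm2)
        rw [show j - 3 + 1 = j - 2 by omega] at hXm3
        have hm31 := hne (j - 3) (j - 1) (by omega) (by omega) (by omega)
        have hXm2 : ω (j - 2) 0 = 4 * ω (j + 1) 0 - 3 * ω (j + 2) 0 := by clear hXm3 hm31; omega
        refine ⟨hYm2, hXm2, hYm3, ?_⟩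
        clear sm2 hm20
        omega
      · right
        constructor <;> omega
    · right
      have hYj' : ω j 1 = -1 := by omega
      have hXj : ω j 0 = ω (j + 1) 0 := by omega
      clear sj hHj h02
      refine ⟨hYj', hXj, ?_⟩
      have sm1 := Arm.step_cases (hbw (j - 1) (by omega))
      rw [show j - 1 + 1 = j by omega] at sm1
      have hHm1 := hH (j - 1) (by omega)
      have hm11 := hne (j - 1) (j + 1) (by omega) (by omega) (by omega)
      omega
  -- forward: `ω (j+3) = (x+σ, 0)`
  obtain ⟨hY3, hX3⟩ := surface_next_step hωh (i := j + 2) (by omega) hk2 hkY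
  rw [show j + 2 + 1 = j + 3 by omega] at hY3 hX3
  have h31 := hne (j + 3) (j + 1) (by omega) (by omega) (by omega)
  have hX3' : ω (j + 3) 0 = 2 * ω (j + 2) 0 - ω (j + 1) 0 := by clear h_prev; omega
  clear hX3 h31
  -- `ω (j+4) = (x+σ, −1)`
  have hn4 : ¬ (ω (j + 4) 1 = 0) := fun h => hno (j + 4) (by omega) (by omega) ⟨by omega, h⟩
  have s4 := Arm.step_cases (hbw (j + 3) (by omega))
  rw [show j + 3 + 1 = j + 4 by omega] at s4
  have hH4 := hH (j + 4) (by omega)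
  have hXY4 : ω (j + 4) 0 = ω (j + 3) 0 ∧ ω (j + 4) 1 = -1 := by clear h_prev; constructor <;> omega
  obtain ⟨hX4, hY4⟩ := hXY4
  clear s4 hn4 hH4
  -- `ω (j+5)`: along depth `−1` (the odd column `x+σ` has no further vertical bond)
  have s5 := Arm.step_cases (hbw (j + 4) (by omega))
  rw [show j + 4 + 1 = j + 5 by omega] at s5
  have h53 := hne (j + 5) (j + 3) (by omega) (by omega) (by omega)
  have hY5 : ω (j + 5) 1 = -1 := by clear h_prev; omega
  have hX5 : ω (j + 5) 0 = 3 * ω (j + 2) 0 - 2 * ω (j + 1) 0 ∨ ω (j + 5) 0 = ω (j + 2) 0 := by clear h_prev; omega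
  exact ⟨hY1, hX2, hxe, h_prev, ⟨hX3', hY3⟩, ⟨by omega, hY4⟩, hY5, hX5⟩

set_option maxHeartbeats 400000 in
/-- **The ten-fibre, backward-under branch** (`j ≥ 4`): if the excursion turns back under its start, `ω (j+5) = (x,−1)`, then it is the LEFT
HOOK — `(x,−2) (x+σ,−2) (x+2σ,−2) (x+2σ,−1) (x+3σ,−1) (x+3σ,0)` and an end on the row next to `(x+3σ,0)`: continuing to `(x−σ,−1)` runs
into `ω j` or is forced along `(x−2σ,−1) (x−3σ,−1) (x−4σ,−1) (x−5σ,−1)` to resurface at `ω (j−3) = (x−5σ,0)` (or meets `ω (j−2) = (x−3σ,−1)`);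
from `(x,−2)` the way back `(x−σ,−2) (x−2σ,−2) (x−2σ,−1)` resurfaces at `ω (j+1)` or `ω (j−1)`; deeper moves cannot resurface by time `j+11`.
[cite: EntingJensen2009, §7.4.2, Fig. 7.10 (brickwork form of the honeycomb lattice)] -/
theorem ten_caseB {j : ℕ} (hj : 4 ≤ j) (hω : ω ∈ fibW (j + 8) (j + 2)) (hX5 : ω (j + 5) 0 = ω (j + 2) 0) :
    (ω (j + 6) 0 = ω (j + 2) 0 ∧ ω (j + 6) 1 = -2) ∧
    (ω (j + 7) 0 = 2 * ω (j + 2) 0 - ω (j + 1) 0 ∧ ω (j + 7) 1 = -2) ∧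
    (ω (j + 8) 0 = 3 * ω (j + 2) 0 - 2 * ω (j + 1) 0 ∧ ω (j + 8) 1 = -2) ∧
    (ω (j + 9) 0 = 3 * ω (j + 2) 0 - 2 * ω (j + 1) 0 ∧ ω (j + 9) 1 = -1) ∧
    (ω (j + 10) 0 = 4 * ω (j + 2) 0 - 3 * ω (j + 1) 0 ∧ ω (j + 10) 1 = -1) ∧
    (ω (j + 11) 0 = 4 * ω (j + 2) 0 - 3 * ω (j + 1) 0 ∧ ω (j + 11) 1 = 0) ∧
    ((ω (j + 12) 0 = 5 * ω (j + 2) 0 - 4 * ω (j + 1) 0 ∨ ω (j + 12) 0 = 3 * ω (j + 2) 0 - 2 * ω (j + 1) 0) ∧ ω (j + 12) 1 = 0) := by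
  obtain ⟨hY1, hX2, hxe, h_prev, ⟨hX3, hY3⟩, ⟨hX4, hY4⟩, hY5, -⟩ := ten_frame hj hω
  have hω' : ω ∈ fibW (j + 8) (j + 2) := hω
  obtain ⟨hωh, -, hend, -, hk2, hkY, hno, -⟩ := fibW_anatomy hω'
  rw [show j + 8 + 4 = j + 12 by omega] at hωh hend
  obtain ⟨hωs, hH⟩ := mem_hpw.1 hωh
  obtain ⟨-, -, hbw, hinj⟩ := mem_saws_iff.1 hωs
  have hne : ∀ a b : ℕ, a ≤ j + 12 → b ≤ j + 12 → a ≠ b → ¬ (ω a 0 = ω b 0 ∧ ω a 1 = ω b 1) := by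
    intro a b ha hb hab h
    have := hinj (show a ∈ {i | i ≤ j + 12} by simp only [Set.mem_setOf_eq]; exact ha)
      (show b ∈ {i | i ≤ j + 12} by simp only [Set.mem_setOf_eq]; exact hb) ((site_two_eq_iff _ _).2 h)
    exact hab this
  obtain ⟨hY11, hX12⟩ : ω (j + 11) 1 = 0 ∧ (ω (j + 11 + 1) 0 = ω (j + 11) 0 + 1 ∨ ω (j + 11) 0 = ω (j + 11 + 1) 0 + 1) :=
    arch_last_step (n := j + 11) (by rw [show j + 11 + 1 = j + 8 + 4 by omega]; exact (Finset.mem_filter.1 hω').1)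
  rw [show j + 11 + 1 = j + 12 by omega] at hX12
  have hn6 : ¬ (ω (j + 6) 1 = 0) := fun h => hno (j + 6) (by omega) (by omega) ⟨by omega, h⟩
  have hn8 : ¬ (ω (j + 8) 1 = 0) := fun h => hno (j + 8) (by omega) (by omega) ⟨by omega, h⟩
  have hn10 : ¬ (ω (j + 10) 1 = 0) := fun h => hno (j + 10) (by omega) (by omega) ⟨by omega, h⟩
  -- step `j+6`: `(x−σ,−1)` or `(x,−2)`
  have s6 := Arm.step_cases (hbw (j + 5) (by omega))
  rw [show j + 5 + 1 = j + 6 by omega] at s6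
  have h64 := hne (j + 6) (j + 4) (by omega) (by omega) (by omega)
  have hH6 := hH (j + 6) (by omega)
  have h6 : (ω (j + 6) 0 = ω (j + 1) 0 ∧ ω (j + 6) 1 = -1) ∨ (ω (j + 6) 0 = ω (j + 2) 0 ∧ ω (j + 6) 1 = -2) := by
    clear h_prev hX12 hY11 hn8 hn10
    omega
  clear s6 h64 hH6
  -- the step facts we shall need
  have s7 := Arm.step_cases (hbw (j + 6) (by omega))
  rw [show j + 6 + 1 = j + 7 by omega] at s7
  have s8 := Arm.step_cases (hbw (j + 7) (by omega))
  rw [show j + 7 + 1 = j + 8 by omega] at s8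
  have s9 := Arm.step_cases (hbw (j + 8) (by omega))
  rw [show j + 8 + 1 = j + 9 by omega] at s9
  have s10 := Arm.step_cases (hbw (j + 9) (by omega))
  rw [show j + 9 + 1 = j + 10 by omega] at s10
  have s11 := Arm.step_cases (hbw (j + 10) (by omega))
  rw [show j + 10 + 1 = j + 11 by omega] at s11
  have hH7 := hH (j + 7) (by omega)
  have hH8 := hH (j + 8) (by omega)
  have hH9 := hH (j + 9) (by omega)
  have hH10 := hH (j + 10) (by omega)
  rcases h6 with ⟨hX6, hY6⟩ | ⟨hX6, hY6⟩
  · -- B1: `(x−σ,−1)`: dead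
    exfalso
    rcases h_prev with ⟨hYj, hXj, hYm1, hXm1, hdeep⟩ | ⟨hYj, hXj, -⟩
    · -- `ω (j+7) = (x−2σ,−1)`
      have h75 := hne (j + 7) (j + 5) (by omega) (by omega) (by omega)
      have h71 := hne (j + 7) (j + 1) (by omega) (by omega) (by omega)
      have hXY7 : ω (j + 7) 0 = 2 * ω (j + 1) 0 - ω (j + 2) 0 ∧ ω (j + 7) 1 = -1 := by
        clear s8 s9 s10 s11 hX12 hdeep hXm1 hYm1 hH8 hH9 hH10 hn8 hn10
        constructor <;> omega
      obtain ⟨hX7, hY7⟩ := hXY7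
      clear s7 h75 h71 hH7
      -- `ω (j+8)`: `(x−3σ,−1)` or `(x−2σ,−2)`
      have h86 := hne (j + 8) (j + 6) (by omega) (by omega) (by omega)
      have h8 : (ω (j + 8) 0 = 3 * ω (j + 1) 0 - 2 * ω (j + 2) 0 ∧ ω (j + 8) 1 = -1) ∨
          (ω (j + 8) 0 = 2 * ω (j + 1) 0 - ω (j + 2) 0 ∧ ω (j + 8) 1 = -2) := by
        clear s9 s10 s11 hX12 hdeep hXm1 hYm1 hH9 hH10 hn10 hX3 hX4 hX5
        omega
      clear s8 h86 hH8 hn8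
      rcases h8 with ⟨hX8, hY8⟩ | ⟨hX8, hY8⟩
      · -- `(x−3σ,−1)`: forced on to `(x−4σ,−1) (x−5σ,−1) (x−5σ,0)`, which is `ω (j−3)` (or `(x−3σ,−1) = ω (j−2)`)
        have h97 := hne (j + 9) (j + 7) (by omega) (by omega) (by omega)
        have h9m1 := hne (j + 9) (j - 1) (by omega) (by omega) (by omega)
        have hXY9 : ω (j + 9) 0 = 4 * ω (j + 1) 0 - 3 * ω (j + 2) 0 ∧ ω (j + 9) 1 = -1 := by
          clear s10 s11 hX12 hdeep hH10 hn10 hX3 hX4 hX5 hX6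
          constructor <;> omega
        obtain ⟨hX9, hY9⟩ := hXY9
        clear s9 h97 h9m1 hH9
        have h108 := hne (j + 10) (j + 8) (by omega) (by omega) (by omega)
        have hXY10 : ω (j + 10) 0 = 5 * ω (j + 1) 0 - 4 * ω (j + 2) 0 ∧ ω (j + 10) 1 = -1 := by
          clear hX12 hdeep hX3 hX4 hX5 hX6 hX7 hXm1 hYm1
          constructor <;> omega
        obtain ⟨hX10, hY10⟩ := hXY10
        clear s10 h108 hH10 hn10
        have hX11 : ω (j + 11) 0 = 5 * ω (j + 1) 0 - 4 * ω (j + 2) 0 := by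
          clear hX12 hdeep hX3 hX4 hX5 hX6 hX7 hX8 hX9 hXm1
          omega
        clear s11
        rcases hdeep with ⟨hYm2, hXm2, hYm3, hXm3⟩ | ⟨hYm2, hXm2⟩
        · exact hne (j + 11) (j - 3) (by omega) (by omega) (by omega) ⟨by rw [hX11, hXm3], by rw [hY11, hYm3]⟩
        · exact hne (j + 8) (j - 2) (by omega) (by omega) (by omega) ⟨by rw [hX8, hXm2], by rw [hY8, hYm2]⟩
      · -- `(x−2σ,−2)`: cannot resurface by `j+11`
        have h97 := hne (j + 9) (j + 7) (by omega) (by omega) (by omega)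
        have hY9 : ω (j + 9) 1 = -2 := by
          clear s10 s11 hX12 hdeep hH10 hn10 hX3 hX4 hX5 hX6 hXm1
          omega
        have hx9 : (ω (j + 9) 0 + ω (j + 9) 1) % 2 ≠ 0 := by
          have := parity_apply hωs (i := j + 9) (by omega); push_cast at this; omega
        clear s9 h97 hH9 hdeep hX3 hX4 hX5 hX6 hX7 hX8 hXm1 hXj hX2
        have hY10 : ω (j + 10) 1 ≤ -2 := by clear s11 hX12; omega
        clear s10
        omega
    · exact hne (j + 6) j (by omega) (by omega) (by omega) ⟨by rw [hX6, hXj], by rw [hY6, hYj]⟩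
  · -- B2: `(x,−2)`; `ω (j+7) = (x±σ, −2)`
    have h75 := hne (j + 7) (j + 5) (by omega) (by omega) (by omega)
    have h7 : ω (j + 7) 1 = -2 ∧ (ω (j + 7) 0 = ω (j + 1) 0 ∨ ω (j + 7) 0 = 2 * ω (j + 2) 0 - ω (j + 1) 0) := by
      clear s8 s9 s10 s11 hX12 h_prev hH8 hH9 hH10 hn8 hn10
      constructor <;> omega
    obtain ⟨hY7, hX7⟩ := h7
    clear s7 h75 hH7
    rcases hX7 with hX7 | hX7
    · -- B2b: `(x−σ,−2)`: dead
      exfalso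
      have h86 := hne (j + 8) (j + 6) (by omega) (by omega) (by omega)
      have h8 : (ω (j + 8) 0 = ω (j + 1) 0 ∧ ω (j + 8) 1 = -3) ∨ (ω (j + 8) 0 = 2 * ω (j + 1) 0 - ω (j + 2) 0 ∧ ω (j + 8) 1 = -2) := by
        clear s9 s10 s11 hX12 h_prev hH9 hH10 hn10 hX3 hX4 hX5
        omega
      clear s8 h86 hH8 hn8
      rcases h8 with ⟨hX8, hY8⟩ | ⟨hX8, hY8⟩
      · -- depth `−3`: no return
        have h97 := hne (j + 9) (j + 7) (by omega) (by omega) (by omega)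
        have hY9 : ω (j + 9) 1 ≤ -3 := by
          clear s10 s11 hX12 h_prev hH10 hn10 hX3 hX4 hX5 hX6
          omega
        clear s9 h97 h_prev hX3 hX4 hX5 hX6 hX7 hX8 hX2
        have hY10 : ω (j + 10) 1 ≤ -2 := by clear s11 hX12; omega
        clear s10
        omega
      · -- `(x−2σ,−2)`; then `(x−3σ,−2)` (no return) or up to `(x−2σ,−1)`
        have h97 := hne (j + 9) (j + 7) (by omega) (by omega) (by omega)
        have h9 : (ω (j + 9) 0 = 3 * ω (j + 1) 0 - 2 * ω (j + 2) 0 ∧ ω (j + 9) 1 = -2) ∨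
            (ω (j + 9) 0 = 2 * ω (j + 1) 0 - ω (j + 2) 0 ∧ ω (j + 9) 1 = -1) := by
          clear s10 s11 hX12 h_prev hH10 hn10 hX3 hX4 hX5 hX6
          omega
        clear s9 h97 hH9
        rcases h9 with ⟨hX9, hY9⟩ | ⟨hX9, hY9⟩
        · have hx9 : (ω (j + 9) 0 + ω (j + 9) 1) % 2 ≠ 0 := by
            have := parity_apply hωs (i := j + 9) (by omega); push_cast at this; omega
          clear h_prev hX3 hX4 hX5 hX6 hX7 hX8 hX9 hX2
          have hY10 : ω (j + 10) 1 ≤ -2 := by clear s11 hX12; omega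
          clear s10
          omega
        · have h108 := hne (j + 10) (j + 8) (by omega) (by omega) (by omega)
          have h10 : ω (j + 10) 1 = -1 ∧ (ω (j + 10) 0 = 3 * ω (j + 1) 0 - 2 * ω (j + 2) 0 ∨ ω (j + 10) 0 = ω (j + 1) 0) := by
            clear hX12 h_prev hX3 hX4 hX5 hX6 hX7
            constructor <;> omega
          obtain ⟨hY10, hX10⟩ := h10
          clear s10 h108 hH10 hn10
          have hX11 : ω (j + 11) 0 = ω (j + 10) 0 := by
            clear hX12 h_prev hX3 hX4 hX5 hX6 hX7 hX8 hX9 hX10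
            omega
          clear s11
          rcases hX10 with hX10 | hX10
          · rcases h_prev with ⟨-, -, hYm1, hXm1, -⟩ | ⟨-, -, hm1⟩
            · exact hne (j + 11) (j - 1) (by omega) (by omega) (by omega) ⟨by rw [hX11, hX10, hXm1], by rw [hY11, hYm1]⟩
            · rcases hm1 with ⟨hYm1, hXm1⟩ | ⟨hYm1, hXm1⟩ | ⟨hYm1, hXm1⟩
              · exact hne (j + 9) (j - 1) (by omega) (by omega) (by omega) ⟨by rw [hX9, hXm1], by rw [hY9, hYm1]⟩
              · exact hne (j + 5) (j - 1) (by omega) (by omega) (by omega) ⟨by rw [hX5, hXm1], by rw [hY5, hYm1]⟩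
              · exact hne (j + 7) (j - 1) (by omega) (by omega) (by omega) ⟨by rw [hX7, hXm1], by rw [hY7, hYm1]⟩
          · exact hne (j + 11) (j + 1) (by omega) (by omega) (by omega) ⟨by rw [hX11, hX10], by rw [hY11, hY1]⟩
    · -- B2a: `(x+σ,−2)`: the left hook
      clear h_prev
      have h86 := hne (j + 8) (j + 6) (by omega) (by omega) (by omega)
      have h8 : (ω (j + 8) 0 = 2 * ω (j + 2) 0 - ω (j + 1) 0 ∧ ω (j + 8) 1 = -3) ∨
          (ω (j + 8) 0 = 3 * ω (j + 2) 0 - 2 * ω (j + 1) 0 ∧ ω (j + 8) 1 = -2) := by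
        clear s9 s10 s11 hX12 hH9 hH10 hn10 hX3 hX4 hX5
        omega
      clear s8 h86 hH8 hn8
      rcases h8 with ⟨hX8, hY8⟩ | ⟨hX8, hY8⟩
      · exfalso
        have h97 := hne (j + 9) (j + 7) (by omega) (by omega) (by omega)
        have hY9 : ω (j + 9) 1 ≤ -3 := by
          clear s10 s11 hX12 hH10 hn10 hX3 hX4 hX5 hX6
          omega
        clear s9 h97 hX3 hX4 hX5 hX6 hX7 hX8 hX2
        have hY10 : ω (j + 10) 1 ≤ -2 := by clear s11 hX12; omega
        clear s10
        omega
      · have h97 := hne (j + 9) (j + 7) (by omega) (by omega) (by omega)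
        have h9 : (ω (j + 9) 0 = 4 * ω (j + 2) 0 - 3 * ω (j + 1) 0 ∧ ω (j + 9) 1 = -2) ∨
            (ω (j + 9) 0 = 3 * ω (j + 2) 0 - 2 * ω (j + 1) 0 ∧ ω (j + 9) 1 = -1) := by
          clear s10 s11 hX12 hH10 hn10 hX3 hX4 hX5 hX6
          omega
        clear s9 h97 hH9
        rcases h9 with ⟨hX9, hY9⟩ | ⟨hX9, hY9⟩
        · exfalso
          have hx9 : (ω (j + 9) 0 + ω (j + 9) 1) % 2 ≠ 0 := by
            have := parity_apply hωs (i := j + 9) (by omega); push_cast at this; omega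
          clear hX3 hX4 hX5 hX6 hX7 hX8 hX9 hX2
          have hY10 : ω (j + 10) 1 ≤ -2 := by clear s11 hX12; omega
          clear s10
          omega
        · have h108 := hne (j + 10) (j + 8) (by omega) (by omega) (by omega)
          have h104 := hne (j + 10) (j + 4) (by omega) (by omega) (by omega)
          have h10 : ω (j + 10) 0 = 4 * ω (j + 2) 0 - 3 * ω (j + 1) 0 ∧ ω (j + 10) 1 = -1 := by
            clear hX12 hX5 hX6 hX7
            constructor <;> omega
          obtain ⟨hX10, hY10⟩ := h10
          clear s10 h108 h104 hH10 hn10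
          have hX11 : ω (j + 11) 0 = 4 * ω (j + 2) 0 - 3 * ω (j + 1) 0 := by
            clear hX12 hX3 hX4 hX5 hX6 hX7 hX8 hX9
            omega
          clear s11
          have s12 := Arm.step_cases (hbw (j + 11) (by omega))
          rw [show j + 11 + 1 = j + 12 by omega] at s12
          have h1210 := hne (j + 12) (j + 10) (by omega) (by omega) (by omega)
          refine ⟨⟨hX6, hY6⟩, ⟨hX7, hY7⟩, ⟨hX8, hY8⟩, ⟨hX9, hY9⟩, ⟨hX10, hY10⟩, ⟨hX11, hY11⟩, ?_, hend⟩
          clear hX3 hX4 hX5 hX6 hX7 hX8 hX9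
          omega

set_option maxHeartbeats 400000 in
/-- **The ten-fibre, forward branch** (`j ≥ 4`): if `ω (j+5) = (x+2σ,−1)` then either the walk runs along depth `−1` —
`(x+3σ,−1) (x+4σ,−1) (x+5σ,−1) (x+6σ,−1) (x+7σ,−1) (x+7σ,0)` and an end next to `(x+7σ,0)` (the long flat or its late hook) — or it drops to
depth `−2` at `x+2σ` and returns along `(x+3σ,−2) (x+4σ,−2) (x+4σ,−1)`, then `(x+5σ,−1) (x+5σ,0)` or `(x+3σ,−1) (x+3σ,0)` and an end on
the row (the terrace, the right hook, or their backward ends).  Surfacing at an odd vertex would make the next even time a surface visit;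
`(x+σ,−2) (x,−2) (x,−1) (x−σ,−1)` resurfaces at `ω (j+1)`; deeper moves cannot resurface by time `j+11`.
[cite: EntingJensen2009, §7.4.2, Fig. 7.10 (brickwork form of the honeycomb lattice)] -/
theorem ten_caseA {j : ℕ} (hj : 4 ≤ j) (hω : ω ∈ fibW (j + 8) (j + 2)) (hX5 : ω (j + 5) 0 = 3 * ω (j + 2) 0 - 2 * ω (j + 1) 0) :
    ((ω (j + 6) 0 = 4 * ω (j + 2) 0 - 3 * ω (j + 1) 0 ∧ ω (j + 6) 1 = -1) ∧
      (ω (j + 7) 0 = 5 * ω (j + 2) 0 - 4 * ω (j + 1) 0 ∧ ω (j + 7) 1 = -1) ∧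
      (ω (j + 8) 0 = 6 * ω (j + 2) 0 - 5 * ω (j + 1) 0 ∧ ω (j + 8) 1 = -1) ∧
      (ω (j + 9) 0 = 7 * ω (j + 2) 0 - 6 * ω (j + 1) 0 ∧ ω (j + 9) 1 = -1) ∧
      (ω (j + 10) 0 = 8 * ω (j + 2) 0 - 7 * ω (j + 1) 0 ∧ ω (j + 10) 1 = -1) ∧
      (ω (j + 11) 0 = 8 * ω (j + 2) 0 - 7 * ω (j + 1) 0 ∧ ω (j + 11) 1 = 0) ∧
      ((ω (j + 12) 0 = 9 * ω (j + 2) 0 - 8 * ω (j + 1) 0 ∨ ω (j + 12) 0 = 7 * ω (j + 2) 0 - 6 * ω (j + 1) 0) ∧ ω (j + 12) 1 = 0)) ∨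
    ((ω (j + 6) 0 = 3 * ω (j + 2) 0 - 2 * ω (j + 1) 0 ∧ ω (j + 6) 1 = -2) ∧
      (ω (j + 7) 0 = 4 * ω (j + 2) 0 - 3 * ω (j + 1) 0 ∧ ω (j + 7) 1 = -2) ∧
      (ω (j + 8) 0 = 5 * ω (j + 2) 0 - 4 * ω (j + 1) 0 ∧ ω (j + 8) 1 = -2) ∧
      (ω (j + 9) 0 = 5 * ω (j + 2) 0 - 4 * ω (j + 1) 0 ∧ ω (j + 9) 1 = -1) ∧
      ((ω (j + 10) 0 = 6 * ω (j + 2) 0 - 5 * ω (j + 1) 0 ∨ ω (j + 10) 0 = 4 * ω (j + 2) 0 - 3 * ω (j + 1) 0) ∧ ω (j + 10) 1 = -1) ∧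
      (ω (j + 11) 0 = ω (j + 10) 0 ∧ ω (j + 11) 1 = 0) ∧
      ((ω (j + 12) 0 = ω (j + 11) 0 + (ω (j + 2) 0 - ω (j + 1) 0) ∨ ω (j + 12) 0 = ω (j + 11) 0 - (ω (j + 2) 0 - ω (j + 1) 0)) ∧
        ω (j + 12) 1 = 0)) := by
  obtain ⟨hY1, hX2, hxe, -, ⟨hX3, hY3⟩, ⟨hX4, hY4⟩, hY5, -⟩ := ten_frame hj hω
  have hω' : ω ∈ fibW (j + 8) (j + 2) := hω
  obtain ⟨hωh, -, hend, -, hk2, hkY, hno, -⟩ := fibW_anatomy hω'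
  rw [show j + 8 + 4 = j + 12 by omega] at hωh hend
  obtain ⟨hωs, hH⟩ := mem_hpw.1 hωh
  obtain ⟨-, -, hbw, hinj⟩ := mem_saws_iff.1 hωs
  have hne : ∀ a b : ℕ, a ≤ j + 12 → b ≤ j + 12 → a ≠ b → ¬ (ω a 0 = ω b 0 ∧ ω a 1 = ω b 1) := by
    intro a b ha hb hab h
    have := hinj (show a ∈ {i | i ≤ j + 12} by simp only [Set.mem_setOf_eq]; exact ha)
      (show b ∈ {i | i ≤ j + 12} by simp only [Set.mem_setOf_eq]; exact hb) ((site_two_eq_iff _ _).2 h)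
    exact hab this
  obtain ⟨hY11, hX12⟩ : ω (j + 11) 1 = 0 ∧ (ω (j + 11 + 1) 0 = ω (j + 11) 0 + 1 ∨ ω (j + 11) 0 = ω (j + 11 + 1) 0 + 1) :=
    arch_last_step (n := j + 11) (by rw [show j + 11 + 1 = j + 8 + 4 by omega]; exact (Finset.mem_filter.1 hω').1)
  rw [show j + 11 + 1 = j + 12 by omega] at hX12
  have hn6 : ¬ (ω (j + 6) 1 = 0) := fun h => hno (j + 6) (by omega) (by omega) ⟨by omega, h⟩
  have hn8 : ¬ (ω (j + 8) 1 = 0) := fun h => hno (j + 8) (by omega) (by omega) ⟨by omega, h⟩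
  have hn10 : ¬ (ω (j + 10) 1 = 0) := fun h => hno (j + 10) (by omega) (by omega) ⟨by omega, h⟩
  -- step `j+6`: `(x+3σ,−1)` or `(x+2σ,−2)`
  have s6 := Arm.step_cases (hbw (j + 5) (by omega))
  rw [show j + 5 + 1 = j + 6 by omega] at s6
  have h64 := hne (j + 6) (j + 4) (by omega) (by omega) (by omega)
  have hH6 := hH (j + 6) (by omega)
  have h6 : (ω (j + 6) 0 = 4 * ω (j + 2) 0 - 3 * ω (j + 1) 0 ∧ ω (j + 6) 1 = -1) ∨
      (ω (j + 6) 0 = 3 * ω (j + 2) 0 - 2 * ω (j + 1) 0 ∧ ω (j + 6) 1 = -2) := by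
    clear hX12 hY11 hn8 hn10
    omega
  clear s6 h64 hH6
  have s7 := Arm.step_cases (hbw (j + 6) (by omega))
  rw [show j + 6 + 1 = j + 7 by omega] at s7
  have s8 := Arm.step_cases (hbw (j + 7) (by omega))
  rw [show j + 7 + 1 = j + 8 by omega] at s8
  have s9 := Arm.step_cases (hbw (j + 8) (by omega))
  rw [show j + 8 + 1 = j + 9 by omega] at s9
  have s10 := Arm.step_cases (hbw (j + 9) (by omega))
  rw [show j + 9 + 1 = j + 10 by omega] at s10
  have s11 := Arm.step_cases (hbw (j + 10) (by omega))
  rw [show j + 10 + 1 = j + 11 by omega] at s11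
  have s12 := Arm.step_cases (hbw (j + 11) (by omega))
  rw [show j + 11 + 1 = j + 12 by omega] at s12
  have hH7 := hH (j + 7) (by omega)
  have hH8 := hH (j + 8) (by omega)
  have hH9 := hH (j + 9) (by omega)
  have hH10 := hH (j + 10) (by omega)
  rcases h6 with ⟨hX6, hY6⟩ | ⟨hX6, hY6⟩
  · -- A1: along depth `−1`
    left
    have h75 := hne (j + 7) (j + 5) (by omega) (by omega) (by omega)
    have h86 := hne (j + 8) (j + 6) (by omega) (by omega) (by omega)
    -- `ω (j+7) = (x+4σ,−1)` (surfacing at `(x+3σ,0)` would make `j+8` a visit)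
    have hXY7 : ω (j + 7) 0 = 5 * ω (j + 2) 0 - 4 * ω (j + 1) 0 ∧ ω (j + 7) 1 = -1 := by
      clear s9 s10 s11 s12 hX12 hH9 hH10 hn10 hX3 hX4
      constructor <;> omega
    obtain ⟨hX7, hY7⟩ := hXY7
    clear s7 h75 hH7
    have h8 : (ω (j + 8) 0 = 6 * ω (j + 2) 0 - 5 * ω (j + 1) 0 ∧ ω (j + 8) 1 = -1) ∨
        (ω (j + 8) 0 = 5 * ω (j + 2) 0 - 4 * ω (j + 1) 0 ∧ ω (j + 8) 1 = -2) := by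
      clear s9 s10 s11 s12 hX12 hH9 hH10 hn10 hX3 hX4 hX5
      omega
    clear s8 h86 hH8 hn8
    rcases h8 with ⟨hX8, hY8⟩ | ⟨hX8, hY8⟩
    · have h97 := hne (j + 9) (j + 7) (by omega) (by omega) (by omega)
      have h108 := hne (j + 10) (j + 8) (by omega) (by omega) (by omega)
      -- `ω (j+9) = (x+6σ,−1)` (surfacing at `(x+5σ,0)` would make `j+10` a visit)
      have hXY9 : ω (j + 9) 0 = 7 * ω (j + 2) 0 - 6 * ω (j + 1) 0 ∧ ω (j + 9) 1 = -1 := by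
        clear s11 s12 hX12 hX3 hX4 hX5 hX6
        constructor <;> omega
      obtain ⟨hX9, hY9⟩ := hXY9
      clear s9 h97 hH9
      have hXY10 : ω (j + 10) 0 = 8 * ω (j + 2) 0 - 7 * ω (j + 1) 0 ∧ ω (j + 10) 1 = -1 := by
        clear s12 hX12 hX3 hX4 hX5 hX6 hX7
        constructor <;> omega
      obtain ⟨hX10, hY10⟩ := hXY10
      clear s10 h108 hH10 hn10
      have hX11 : ω (j + 11) 0 = 8 * ω (j + 2) 0 - 7 * ω (j + 1) 0 := by
        clear s12 hX12 hX3 hX4 hX5 hX6 hX7 hX8 hX9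
        omega
      clear s11
      have h1210 := hne (j + 12) (j + 10) (by omega) (by omega) (by omega)
      refine ⟨⟨hX6, hY6⟩, ⟨hX7, hY7⟩, ⟨hX8, hY8⟩, ⟨hX9, hY9⟩, ⟨hX10, hY10⟩, ⟨hX11, hY11⟩, ?_, hend⟩
      clear hX3 hX4 hX5 hX6 hX7 hX8 hX9
      omega
    · -- A1b: `(x+4σ,−2)`: no return by `j+11`
      exfalso
      have h97 := hne (j + 9) (j + 7) (by omega) (by omega) (by omega)
      have hY9 : ω (j + 9) 1 = -2 := by
        clear s10 s11 s12 hX12 hH10 hn10 hX3 hX4 hX5 hX6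
        omega
      have hx9 : (ω (j + 9) 0 + ω (j + 9) 1) % 2 ≠ 0 := by
        have := parity_apply hωs (i := j + 9) (by omega); push_cast at this; omega
      clear s9 h97 hH9 hX3 hX4 hX5 hX6 hX7 hX8 hX2
      have hY10 : ω (j + 10) 1 ≤ -2 := by clear s11 s12 hX12; omega
      clear s10 s12
      omega
  · -- A2: `(x+2σ,−2)`; then `(x+σ,−2)` (dead) or `(x+3σ,−2)`
    right
    have h75 := hne (j + 7) (j + 5) (by omega) (by omega) (by omega)
    have h7 : ω (j + 7) 1 = -2 ∧ (ω (j + 7) 0 = 2 * ω (j + 2) 0 - ω (j + 1) 0 ∨ ω (j + 7) 0 = 4 * ω (j + 2) 0 - 3 * ω (j + 1) 0) := by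
      clear s8 s9 s10 s11 s12 hX12 hH8 hH9 hH10 hn8 hn10 hX3 hX4
      constructor <;> omega
    obtain ⟨hY7, hX7⟩ := h7
    clear s7 h75 hH7
    rcases hX7 with hX7 | hX7
    · -- A2b: `(x+σ,−2)`: dead
      exfalso
      have h86 := hne (j + 8) (j + 6) (by omega) (by omega) (by omega)
      have h8 : (ω (j + 8) 0 = 2 * ω (j + 2) 0 - ω (j + 1) 0 ∧ ω (j + 8) 1 = -3) ∨
          (ω (j + 8) 0 = ω (j + 2) 0 ∧ ω (j + 8) 1 = -2) := by
        clear s9 s10 s11 s12 hX12 hH9 hH10 hn10 hX3 hX4 hX5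
        omega
      clear s8 h86 hH8 hn8
      rcases h8 with ⟨hX8, hY8⟩ | ⟨hX8, hY8⟩
      · have h97 := hne (j + 9) (j + 7) (by omega) (by omega) (by omega)
        have hY9 : ω (j + 9) 1 ≤ -3 := by
          clear s10 s11 s12 hX12 hH10 hn10 hX3 hX4 hX5 hX6
          omega
        clear s9 h97 hX3 hX4 hX5 hX6 hX7 hX8 hX2
        have hY10 : ω (j + 10) 1 ≤ -2 := by clear s11 s12 hX12; omega
        clear s10 s12
        omega
      · have h97 := hne (j + 9) (j + 7) (by omega) (by omega) (by omega)
        have h9 : (ω (j + 9) 0 = ω (j + 1) 0 ∧ ω (j + 9) 1 = -2) ∨ (ω (j + 9) 0 = ω (j + 2) 0 ∧ ω (j + 9) 1 = -1) := by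
          clear s10 s11 s12 hX12 hH10 hn10 hX3 hX4 hX5 hX6
          omega
        clear s9 h97 hH9
        rcases h9 with ⟨hX9, hY9⟩ | ⟨hX9, hY9⟩
        · have hx9 : (ω (j + 9) 0 + ω (j + 9) 1) % 2 ≠ 0 := by
            have := parity_apply hωs (i := j + 9) (by omega); push_cast at this; omega
          clear hX3 hX4 hX5 hX6 hX7 hX8 hX9 hX2
          have hY10 : ω (j + 10) 1 ≤ -2 := by clear s11 s12 hX12; omega
          clear s10 s12
          omega
        · have h108 := hne (j + 10) (j + 8) (by omega) (by omega) (by omega)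
          have h104 := hne (j + 10) (j + 4) (by omega) (by omega) (by omega)
          have h10 : ω (j + 10) 0 = ω (j + 1) 0 ∧ ω (j + 10) 1 = -1 := by
            clear s12 hX12 hX5 hX6 hX7
            constructor <;> omega
          obtain ⟨hX10, hY10⟩ := h10
          clear s10 h108 h104 hH10 hn10
          have hX11 : ω (j + 11) 0 = ω (j + 1) 0 := by
            clear s12 hX12 hX3 hX4 hX5 hX6 hX7 hX8 hX9
            omega
          exact hne (j + 11) (j + 1) (by omega) (by omega) (by omega) ⟨hX11, by rw [hY11, hY1]⟩
    · -- A2a: `(x+3σ,−2) (x+4σ,−2) (x+4σ,−1)` then `(x+5σ,−1)` or `(x+3σ,−1)`, up, and the end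
      have h86 := hne (j + 8) (j + 6) (by omega) (by omega) (by omega)
      have h8 : (ω (j + 8) 0 = 4 * ω (j + 2) 0 - 3 * ω (j + 1) 0 ∧ ω (j + 8) 1 = -3) ∨
          (ω (j + 8) 0 = 5 * ω (j + 2) 0 - 4 * ω (j + 1) 0 ∧ ω (j + 8) 1 = -2) := by
        clear s9 s10 s11 s12 hX12 hH9 hH10 hn10 hX3 hX4 hX5
        omega
      clear s8 h86 hH8 hn8
      rcases h8 with ⟨hX8, hY8⟩ | ⟨hX8, hY8⟩
      · exfalso
        have h97 := hne (j + 9) (j + 7) (by omega) (by omega) (by omega)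
        have hY9 : ω (j + 9) 1 ≤ -3 := by
          clear s10 s11 s12 hX12 hH10 hn10 hX3 hX4 hX5 hX6
          omega
        clear s9 h97 hX3 hX4 hX5 hX6 hX7 hX8 hX2
        have hY10 : ω (j + 10) 1 ≤ -2 := by clear s11 s12 hX12; omega
        clear s10 s12
        omega
      · have h97 := hne (j + 9) (j + 7) (by omega) (by omega) (by omega)
        have h9 : (ω (j + 9) 0 = 6 * ω (j + 2) 0 - 5 * ω (j + 1) 0 ∧ ω (j + 9) 1 = -2) ∨
            (ω (j + 9) 0 = 5 * ω (j + 2) 0 - 4 * ω (j + 1) 0 ∧ ω (j + 9) 1 = -1) := by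
          clear s10 s11 s12 hX12 hH10 hn10 hX3 hX4 hX5 hX6
          omega
        clear s9 h97 hH9
        rcases h9 with ⟨hX9, hY9⟩ | ⟨hX9, hY9⟩
        · exfalso
          have hx9 : (ω (j + 9) 0 + ω (j + 9) 1) % 2 ≠ 0 := by
            have := parity_apply hωs (i := j + 9) (by omega); push_cast at this; omega
          clear hX3 hX4 hX5 hX6 hX7 hX8 hX9 hX2
          have hY10 : ω (j + 10) 1 ≤ -2 := by clear s11 s12 hX12; omega
          clear s10 s12
          omega
        · have h108 := hne (j + 10) (j + 8) (by omega) (by omega) (by omega)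
          have h10 : ω (j + 10) 1 = -1 ∧
              (ω (j + 10) 0 = 6 * ω (j + 2) 0 - 5 * ω (j + 1) 0 ∨ ω (j + 10) 0 = 4 * ω (j + 2) 0 - 3 * ω (j + 1) 0) := by
            clear s12 hX12 hX3 hX4 hX5 hX6 hX7
            constructor <;> omega
          obtain ⟨hY10, hX10⟩ := h10
          clear s10 h108 hH10 hn10
          have hX11 : ω (j + 11) 0 = ω (j + 10) 0 := by
            clear s12 hX12 hX3 hX4 hX5 hX6 hX7 hX8 hX9 hX10
            omega
          clear s11
          refine ⟨⟨hX6, hY6⟩, ⟨hX7, hY7⟩, ⟨hX8, hY8⟩, ⟨hX9, hY9⟩, ⟨hX10, hY10⟩, ⟨hX11, hY11⟩, ?_, hend⟩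
          clear hX3 hX4 hX5 hX6 hX7 hX8 hX9 s12
          omega

/-- **Dead end `(x+2σ,0)`**: an arch ending `… (x+3σ,0) (x+2σ,0)` with `ω (j+3) = (x+σ,0)` has no fresh neighbour in the half-plane (the row site
`(x+2σ,0)` has even parity, hence no downward bond), so it is not `k`-step extendable for any `k ≥ 1` — this kills the backward ends of the right hook
and of the left hook. [cite: EntingJensen2009, §7.4.2, Fig. 7.10 (brickwork form of the honeycomb lattice)] -/
theorem ten_kill_end_two {j : ℕ} (hE : ExtK k (j + 12) ω) (hk : 1 ≤ k) (hxe : ω (j + 2) 0 % 2 = 0)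
    (hX2 : ω (j + 2) 0 = ω (j + 1) 0 + 1 ∨ ω (j + 1) 0 = ω (j + 2) 0 + 1)
    (h3 : ω (j + 3) 0 = 2 * ω (j + 2) 0 - ω (j + 1) 0 ∧ ω (j + 3) 1 = 0)
    (h11 : ω (j + 11) 0 = 4 * ω (j + 2) 0 - 3 * ω (j + 1) 0 ∧ ω (j + 11) 1 = 0)
    (h12 : ω (j + 12) 0 = 3 * ω (j + 2) 0 - 2 * ω (j + 1) 0 ∧ ω (j + 12) 1 = 0) : False := by
  obtain ⟨η, h0, hadj, hY, -, hfresh⟩ := hE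
  have s := Arm.step_cases (hadj 0 (by omega))
  rw [h0, Nat.zero_add] at s
  have hY1 := hY 1 le_rfl hk
  have f3 := hfresh (j + 3) (by omega) 1 le_rfl hk
  have f11 := hfresh (j + 11) (by omega) 1 le_rfl hk
  rw [Ne, site_two_eq_iff] at f3 f11
  omega

set_option maxHeartbeats 400000 in
/-- **Dead end after the terrace, backwards**: `… (x+4σ,−1) (x+5σ,−1) (x+5σ,0) (x+4σ,0)` admits the fresh step `(x+3σ,0)` and then only `(x+2σ,0)`
(boxed by `ω (j+3) = (x+σ,0)`) or `(x+3σ,−1)` (boxed by `ω (j+4) = (x+σ… (x+2σ,−1)` and `ω (j+9) = (x+4σ,−1)`), neither of which has a third fresh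
step: not `k`-step extendable for `k ≥ 3`. [cite: EntingJensen2009, §7.4.2, Fig. 7.10 (brickwork form of the honeycomb lattice)] -/
theorem ten_kill_terrace_back {j : ℕ} (hE : ExtK k (j + 12) ω) (hk : 3 ≤ k) (hxe : ω (j + 2) 0 % 2 = 0)
    (hX2 : ω (j + 2) 0 = ω (j + 1) 0 + 1 ∨ ω (j + 1) 0 = ω (j + 2) 0 + 1)
    (h3 : ω (j + 3) 0 = 2 * ω (j + 2) 0 - ω (j + 1) 0 ∧ ω (j + 3) 1 = 0)
    (h5 : ω (j + 5) 0 = 3 * ω (j + 2) 0 - 2 * ω (j + 1) 0 ∧ ω (j + 5) 1 = -1)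
    (h9 : ω (j + 9) 0 = 5 * ω (j + 2) 0 - 4 * ω (j + 1) 0 ∧ ω (j + 9) 1 = -1)
    (h11 : ω (j + 11) 0 = 6 * ω (j + 2) 0 - 5 * ω (j + 1) 0 ∧ ω (j + 11) 1 = 0)
    (h12 : ω (j + 12) 0 = 5 * ω (j + 2) 0 - 4 * ω (j + 1) 0 ∧ ω (j + 12) 1 = 0) : False := by
  obtain ⟨z₁, z₂, z₃, hz1, hz2, hz3, hz1', hz2', hz3', hz20, hz13, hfresh⟩ := hE.three hk
  rw [brickWallGraph_adj_coord] at hz1 hz2 hz3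
  rw [Ne, site_two_eq_iff] at hz20 hz13
  -- `z₁ = (x+3σ, 0)`
  obtain ⟨f11a, -, -⟩ := hfresh (j + 11) (by omega)
  rw [Ne, site_two_eq_iff] at f11a
  have hz1c : z₁ 0 = 4 * ω (j + 2) 0 - 3 * ω (j + 1) 0 ∧ z₁ 1 = 0 := by
    clear hz2 hz3 hz2' hz3' hz13 hz20 h3 h5 h9
    constructor <;> omega
  obtain ⟨hz1x, hz1y⟩ := hz1c
  clear hz1 f11a
  -- `z₂ = (x+2σ, 0)` or `(x+3σ, −1)`; then no `z₃`
  obtain ⟨-, -, f3c⟩ := hfresh (j + 3) (by omega)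
  obtain ⟨-, -, f5c⟩ := hfresh (j + 5) (by omega)
  obtain ⟨-, -, f9c⟩ := hfresh (j + 9) (by omega)
  rw [Ne, site_two_eq_iff] at f3c f5c f9c
  have hz2c : (z₂ 0 = 3 * ω (j + 2) 0 - 2 * ω (j + 1) 0 ∧ z₂ 1 = 0) ∨ (z₂ 0 = 4 * ω (j + 2) 0 - 3 * ω (j + 1) 0 ∧ z₂ 1 = -1) := by
    clear hz3 hz3' hz13 f3c f5c f9c h3 h5 h9 h11
    omega
  clear hz2 hz20 hz2' h11 h12
  rcases hz2c with ⟨hz2x, hz2y⟩ | ⟨hz2x, hz2y⟩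
  · clear f5c f9c h5 h9
    omega
  · clear f3c h3
    omega

set_option maxHeartbeats 400000 in
/-- **Dead end after the long flat, backwards** (the «late long hook»): `… (x+7σ,−1) (x+7σ,0) (x+6σ,0)` admits exactly the four fresh forced steps
`(x+5σ,0) (x+4σ,0) (x+3σ,0) (x+2σ,0)` (the odd row sites are boxed below by the excursion, the even ones have no downward bond) and no fifth
(`(x+σ,0) = ω (j+3)`): not `k`-step extendable for `k ≥ 5`. [cite: EntingJensen2009, §7.4.2, Fig. 7.10 (brickwork form of the honeycomb lattice)] -/
theorem ten_kill_late_long {j : ℕ} (hE : ExtK k (j + 12) ω) (hk : 5 ≤ k) (hxe : ω (j + 2) 0 % 2 = 0)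
    (hX2 : ω (j + 2) 0 = ω (j + 1) 0 + 1 ∨ ω (j + 1) 0 = ω (j + 2) 0 + 1)
    (h3 : ω (j + 3) 0 = 2 * ω (j + 2) 0 - ω (j + 1) 0 ∧ ω (j + 3) 1 = 0)
    (h6 : ω (j + 6) 0 = 4 * ω (j + 2) 0 - 3 * ω (j + 1) 0 ∧ ω (j + 6) 1 = -1)
    (h8 : ω (j + 8) 0 = 6 * ω (j + 2) 0 - 5 * ω (j + 1) 0 ∧ ω (j + 8) 1 = -1)
    (h11 : ω (j + 11) 0 = 8 * ω (j + 2) 0 - 7 * ω (j + 1) 0 ∧ ω (j + 11) 1 = 0)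
    (h12 : ω (j + 12) 0 = 7 * ω (j + 2) 0 - 6 * ω (j + 1) 0 ∧ ω (j + 12) 1 = 0) : False := by
  obtain ⟨z₁, z₂, z₃, z₄, z₅, hz1, hz2, hz3, hz4, hz5, hz1', hz2', hz3', hz4', hz5', hz20, hz13, hz24, hz35, hfresh⟩ := hE.five hk
  rw [brickWallGraph_adj_coord] at hz1 hz2 hz3 hz4 hz5
  rw [Ne, site_two_eq_iff] at hz20 hz13 hz24 hz35
  obtain ⟨f11a, -, -, -, -⟩ := hfresh (j + 11) (by omega)
  rw [Ne, site_two_eq_iff] at f11a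
  have hz1c : z₁ 0 = 6 * ω (j + 2) 0 - 5 * ω (j + 1) 0 ∧ z₁ 1 = 0 := by
    clear hz2 hz3 hz4 hz5 hz2' hz3' hz4' hz5' hz13 hz24 hz35 hz20 h3 h6 h8
    constructor <;> omega
  obtain ⟨hz1x, hz1y⟩ := hz1c
  clear hz1 f11a
  obtain ⟨-, f8b, -, -, -⟩ := hfresh (j + 8) (by omega)
  rw [Ne, site_two_eq_iff] at f8b
  have hz2c : z₂ 0 = 5 * ω (j + 2) 0 - 4 * ω (j + 1) 0 ∧ z₂ 1 = 0 := by
    clear hz3 hz4 hz5 hz3' hz4' hz5' hz13 hz24 hz35 h3 h6 h11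
    constructor <;> omega
  obtain ⟨hz2x, hz2y⟩ := hz2c
  clear hz2 f8b hz20
  have hz3c : z₃ 0 = 4 * ω (j + 2) 0 - 3 * ω (j + 1) 0 ∧ z₃ 1 = 0 := by
    clear hz4 hz5 hz4' hz5' hz24 hz35 h3 h6 h8 h11 h12
    constructor <;> omega
  obtain ⟨hz3x, hz3y⟩ := hz3c
  clear hz3 hz13
  obtain ⟨-, -, -, f6d, -⟩ := hfresh (j + 6) (by omega)
  rw [Ne, site_two_eq_iff] at f6d
  have hz4c : z₄ 0 = 3 * ω (j + 2) 0 - 2 * ω (j + 1) 0 ∧ z₄ 1 = 0 := by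
    clear hz5 hz5' hz35 h3 h8 h11 h12 hz1x
    constructor <;> omega
  obtain ⟨hz4x, hz4y⟩ := hz4c
  clear hz4 f6d hz24
  obtain ⟨-, -, -, -, f3e⟩ := hfresh (j + 3) (by omega)
  rw [Ne, site_two_eq_iff] at f3e
  clear h6 h8 h11 h12 hz1x hz2x
  omega

/-- Shape tables (`X = x + d_i σ`, `Y = e_i`, `i ≤ 10`) of the four excursions of length ten: the long flat. [cite: EntingJensen2009, §7.4.2, Fig. 7.10] -/
def tenAD : ℕ → ℤ
  | 0 => 0 | 1 => 1 | 2 => 1 | 3 => 2 | 4 => 3 | 5 => 4 | 6 => 5 | 7 => 6 | 8 => 7 | 9 => 7 | _ => 8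
/-- The long flat, heights. [cite: EntingJensen2009, §7.4.2, Fig. 7.10] -/
def tenAE : ℕ → ℤ
  | 2 => -1 | 3 => -1 | 4 => -1 | 5 => -1 | 6 => -1 | 7 => -1 | 8 => -1 | _ => 0
/-- The terrace, abscissae. [cite: EntingJensen2009, §7.4.2, Fig. 7.10] -/
def tenBD : ℕ → ℤ
  | 0 => 0 | 1 => 1 | 2 => 1 | 3 => 2 | 4 => 2 | 5 => 3 | 6 => 4 | 7 => 4 | 8 => 5 | 9 => 5 | _ => 6
/-- The terrace / right hook / left hook, heights (the same profile). [cite: EntingJensen2009, §7.4.2, Fig. 7.10] -/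
def tenBE : ℕ → ℤ
  | 2 => -1 | 3 => -1 | 4 => -2 | 5 => -2 | 6 => -2 | 7 => -1 | 8 => -1 | _ => 0
/-- The right hook, abscissae. [cite: EntingJensen2009, §7.4.2, Fig. 7.10] -/
def tenCD : ℕ → ℤ
  | 0 => 0 | 1 => 1 | 2 => 1 | 3 => 2 | 4 => 2 | 5 => 3 | 6 => 4 | 7 => 4 | 8 => 3 | 9 => 3 | _ => 4
/-- The left hook, abscissae. [cite: EntingJensen2009, §7.4.2, Fig. 7.10] -/
def tenLD : ℕ → ℤ
  | 0 => 0 | 1 => 1 | 2 => 1 | 3 => 0 | 4 => 0 | 5 => 1 | 6 => 2 | 7 => 2 | 8 => 3 | 9 => 3 | _ => 4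

/-- A shape predicate: the last ten steps follow the tables `d`, `e`. [cite: EntingJensen2009, §7.4.2, Fig. 7.10] -/
def TenShape (d e : ℕ → ℤ) (j : ℕ) (ω : ℕ → Site 2) : Prop :=
  ∀ i ≤ 10, ω (j + 2 + i) 0 = ω (j + 2) 0 + d i * (ω (j + 2) 0 - ω (j + 1) 0) ∧ ω (j + 2 + i) 1 = e i

set_option maxHeartbeats 400000 in
/-- ★★★ **THE TEN-FIBRE UNDER FIVE-STEP EXTENDABILITY** (`j ≥ 4`, `k ≥ 5`): an arch of length `j+12` whose last surface visit before the end is at time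
`j+2` and which admits a fresh five-step continuation ends with one of FOUR excursions — the long flat, the terrace, the right hook or the left hook
(`TenShape` with the tables above). [cite: EntingJensen2009, §7.4.2, Fig. 7.10 (brickwork form of the honeycomb lattice); HammersleyTorrieWhittington1982, §2] -/
theorem ten_coords5 {j : ℕ} (hj : 4 ≤ j) (hω : ω ∈ fibW (j + 8) (j + 2)) (hE : ExtK k (j + 12) ω) (hk : 5 ≤ k) :
    TenShape tenAD tenAE j ω ∨ TenShape tenBD tenBE j ω ∨ TenShape tenCD tenBE j ω ∨ TenShape tenLD tenBE j ω := by
  obtain ⟨hY1, hX2, hxe, -, ⟨hX3, hY3⟩, ⟨hX4, hY4⟩, hY5, hX5⟩ := ten_frame hj hω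
  obtain ⟨-, -, -, -, -, hkY, -, -⟩ := fibW_anatomy hω
  have e0 : j + 2 + 0 = j + 2 := by omega
  have e1 : j + 2 + 1 = j + 3 := by omega
  have e2 : j + 2 + 2 = j + 4 := by omega
  have e3 : j + 2 + 3 = j + 5 := by omega
  have e4 : j + 2 + 4 = j + 6 := by omega
  have e5 : j + 2 + 5 = j + 7 := by omega
  have e6 : j + 2 + 6 = j + 8 := by omega
  have e7 : j + 2 + 7 = j + 9 := by omega
  have e8 : j + 2 + 8 = j + 10 := by omega
  have e9 : j + 2 + 9 = j + 11 := by omega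
  have e10 : j + 2 + 10 = j + 12 := by omega
  -- eleven-way case split on the time index, shared by the four shapes
  have split : ∀ {d e : ℕ → ℤ},
      (ω (j + 2) 0 = ω (j + 2) 0 + d 0 * (ω (j + 2) 0 - ω (j + 1) 0) ∧ ω (j + 2) 1 = e 0) →
      (ω (j + 3) 0 = ω (j + 2) 0 + d 1 * (ω (j + 2) 0 - ω (j + 1) 0) ∧ ω (j + 3) 1 = e 1) →
      (ω (j + 4) 0 = ω (j + 2) 0 + d 2 * (ω (j + 2) 0 - ω (j + 1) 0) ∧ ω (j + 4) 1 = e 2) →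
      (ω (j + 5) 0 = ω (j + 2) 0 + d 3 * (ω (j + 2) 0 - ω (j + 1) 0) ∧ ω (j + 5) 1 = e 3) →
      (ω (j + 6) 0 = ω (j + 2) 0 + d 4 * (ω (j + 2) 0 - ω (j + 1) 0) ∧ ω (j + 6) 1 = e 4) →
      (ω (j + 7) 0 = ω (j + 2) 0 + d 5 * (ω (j + 2) 0 - ω (j + 1) 0) ∧ ω (j + 7) 1 = e 5) →
      (ω (j + 8) 0 = ω (j + 2) 0 + d 6 * (ω (j + 2) 0 - ω (j + 1) 0) ∧ ω (j + 8) 1 = e 6) →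
      (ω (j + 9) 0 = ω (j + 2) 0 + d 7 * (ω (j + 2) 0 - ω (j + 1) 0) ∧ ω (j + 9) 1 = e 7) →
      (ω (j + 10) 0 = ω (j + 2) 0 + d 8 * (ω (j + 2) 0 - ω (j + 1) 0) ∧ ω (j + 10) 1 = e 8) →
      (ω (j + 11) 0 = ω (j + 2) 0 + d 9 * (ω (j + 2) 0 - ω (j + 1) 0) ∧ ω (j + 11) 1 = e 9) →
      (ω (j + 12) 0 = ω (j + 2) 0 + d 10 * (ω (j + 2) 0 - ω (j + 1) 0) ∧ ω (j + 12) 1 = e 10) → TenShape d e j ω := by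
    intro d e a0 a1 a2 a3 a4 a5 a6 a7 a8 a9 a10 i hi
    have hcase : i = 0 ∨ i = 1 ∨ i = 2 ∨ i = 3 ∨ i = 4 ∨ i = 5 ∨ i = 6 ∨ i = 7 ∨ i = 8 ∨ i = 9 ∨ i = 10 := by omega
    rcases hcase with rfl | rfl | rfl | rfl | rfl | rfl | rfl | rfl | rfl | rfl | rfl
    · rwa [e0]
    · rwa [e1]
    · rwa [e2]
    · rwa [e3]
    · rwa [e4]
    · rwa [e5]
    · rwa [e6]
    · rwa [e7]
    · rwa [e8]
    · rwa [e9]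
    · rwa [e10]
  have b0 : ∀ {d e : ℕ → ℤ}, d 0 = 0 → e 0 = 0 → (ω (j + 2) 0 = ω (j + 2) 0 + d 0 * (ω (j + 2) 0 - ω (j + 1) 0) ∧ ω (j + 2) 1 = e 0) :=
    fun hd he => ⟨by rw [hd]; ring, by rw [he]; exact hkY⟩
  have b1 : ∀ {d e : ℕ → ℤ}, d 1 = 1 → e 1 = 0 → (ω (j + 3) 0 = ω (j + 2) 0 + d 1 * (ω (j + 2) 0 - ω (j + 1) 0) ∧ ω (j + 3) 1 = e 1) :=
    fun hd he => ⟨by rw [hd, hX3]; ring, by rw [he]; exact hY3⟩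
  have b2 : ∀ {d e : ℕ → ℤ}, d 2 = 1 → e 2 = -1 → (ω (j + 4) 0 = ω (j + 2) 0 + d 2 * (ω (j + 2) 0 - ω (j + 1) 0) ∧ ω (j + 4) 1 = e 2) :=
    fun hd he => ⟨by rw [hd, hX4]; ring, by rw [he]; exact hY4⟩
  -- a generic single-time packer
  have pk : ∀ {t : ℕ} {a b c : ℤ} {d e : ℕ → ℤ} {i : ℕ}, ω t 0 = a * ω (j + 2) 0 - b * ω (j + 1) 0 → ω t 1 = c → a = 1 + d i → b = d i →
      e i = c → (ω t 0 = ω (j + 2) 0 + d i * (ω (j + 2) 0 - ω (j + 1) 0) ∧ ω t 1 = e i) := by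
    intro t a b c d e i hx hy ha hb hc
    refine ⟨?_, by rw [hc]; exact hy⟩
    rw [hx, ha, hb]; ring
  rcases hX5 with hX5 | hX5
  · rcases ten_caseA hj hω hX5 with ⟨⟨hX6, hY6⟩, ⟨hX7, hY7⟩, ⟨hX8, hY8⟩, ⟨hX9, hY9⟩, ⟨hX10, hY10⟩, ⟨hX11, hY11⟩, hX12, hY12⟩ |
        ⟨⟨hX6, hY6⟩, ⟨hX7, hY7⟩, ⟨hX8, hY8⟩, ⟨hX9, hY9⟩, ⟨hX10, hY10⟩, ⟨hX11, hY11⟩, hX12, hY12⟩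
    · -- the long flat or its late hook
      rcases hX12 with hX12 | hX12
      · left
        exact split (b0 rfl rfl) (b1 rfl rfl) (b2 rfl rfl) (pk hX5 hY5 (by rfl) rfl rfl) (pk hX6 hY6 (by rfl) rfl rfl)
          (pk hX7 hY7 (by rfl) rfl rfl) (pk hX8 hY8 (by rfl) rfl rfl) (pk hX9 hY9 (by rfl) rfl rfl) (pk hX10 hY10 (by rfl) rfl rfl)
          (pk hX11 hY11 (by rfl) rfl rfl) (pk hX12 hY12 (by rfl) rfl rfl)
      · exact (ten_kill_late_long hE hk hxe hX2 ⟨hX3, hY3⟩ ⟨hX6, hY6⟩ ⟨hX8, hY8⟩ ⟨hX11, hY11⟩ ⟨hX12, hY12⟩).elim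
    · -- the terrace / right hook
      rcases hX10 with hX10 | hX10
      · rw [hX10] at hX11
        rcases hX12 with hX12 | hX12
        · right; left
          have hX12' : ω (j + 12) 0 = 7 * ω (j + 2) 0 - 6 * ω (j + 1) 0 := by rw [hX12, hX11]; ring
          exact split (b0 rfl rfl) (b1 rfl rfl) (b2 rfl rfl) (pk hX5 hY5 (by rfl) rfl rfl) (pk hX6 hY6 (by rfl) rfl rfl)
            (pk hX7 hY7 (by rfl) rfl rfl) (pk hX8 hY8 (by rfl) rfl rfl) (pk hX9 hY9 (by rfl) rfl rfl) (pk hX10 hY10 (by rfl) rfl rfl)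
            (pk hX11 hY11 (by rfl) rfl rfl) (pk hX12' hY12 (by rfl) rfl rfl)
        · have hX12' : ω (j + 12) 0 = 5 * ω (j + 2) 0 - 4 * ω (j + 1) 0 := by rw [hX12, hX11]; ring
          exact (ten_kill_terrace_back hE (by omega) hxe hX2 ⟨hX3, hY3⟩ ⟨hX5, hY5⟩ ⟨hX9, hY9⟩ ⟨hX11, hY11⟩ ⟨hX12', hY12⟩).elim
      · rw [hX10] at hX11
        rcases hX12 with hX12 | hX12
        · right; right; left
          have hX12' : ω (j + 12) 0 = 5 * ω (j + 2) 0 - 4 * ω (j + 1) 0 := by rw [hX12, hX11]; ring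
          exact split (b0 rfl rfl) (b1 rfl rfl) (b2 rfl rfl) (pk hX5 hY5 (by rfl) rfl rfl) (pk hX6 hY6 (by rfl) rfl rfl)
            (pk hX7 hY7 (by rfl) rfl rfl) (pk hX8 hY8 (by rfl) rfl rfl) (pk hX9 hY9 (by rfl) rfl rfl) (pk hX10 hY10 (by rfl) rfl rfl)
            (pk hX11 hY11 (by rfl) rfl rfl) (pk hX12' hY12 (by rfl) rfl rfl)
        · have hX12' : ω (j + 12) 0 = 3 * ω (j + 2) 0 - 2 * ω (j + 1) 0 := by rw [hX12, hX11]; ring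
          exact (ten_kill_end_two hE (by omega) hxe hX2 ⟨hX3, hY3⟩ ⟨hX11, hY11⟩ ⟨hX12', hY12⟩).elim
  · obtain ⟨⟨hX6, hY6⟩, ⟨hX7, hY7⟩, ⟨hX8, hY8⟩, ⟨hX9, hY9⟩, ⟨hX10, hY10⟩, ⟨hX11, hY11⟩, hX12, hY12⟩ := ten_caseB hj hω hX5
    rcases hX12 with hX12 | hX12
    · right; right; right
      have hX5' : ω (j + 5) 0 = 1 * ω (j + 2) 0 - 0 * ω (j + 1) 0 := by rw [hX5]; ring
      have hX6' : ω (j + 6) 0 = 1 * ω (j + 2) 0 - 0 * ω (j + 1) 0 := by rw [hX6]; ring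
      have hX7' : ω (j + 7) 0 = 2 * ω (j + 2) 0 - 1 * ω (j + 1) 0 := by rw [hX7]; ring
      exact split (b0 rfl rfl) (b1 rfl rfl) (b2 rfl rfl) (pk hX5' hY5 (by rfl) rfl rfl) (pk hX6' hY6 (by rfl) rfl rfl)
        (pk hX7' hY7 (by rfl) rfl rfl) (pk hX8 hY8 (by rfl) rfl rfl) (pk hX9 hY9 (by rfl) rfl rfl) (pk hX10 hY10 (by rfl) rfl rfl)
        (pk hX11 hY11 (by rfl) rfl rfl) (pk hX12 hY12 (by rfl) rfl rfl)
    · exact (ten_kill_end_two hE (by omega) hxe hX2 ⟨hX3, hY3⟩ ⟨hX11, hY11⟩ ⟨hX12, hY12⟩).elim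

/-- Sums of nonnegative terms over a union are at most the sum of the two sums. [cite: MadrasSlade1993, §1.2, (1.2.3)] -/
private theorem sum_union_le_add {α : Type*} [DecidableEq α] (A B : Finset α) (f : α → ℝ) (hf : ∀ x, 0 ≤ f x) :
    ∑ x ∈ A ∪ B, f x ≤ ∑ x ∈ A, f x + ∑ x ∈ B, f x := by
  rw [← Finset.sum_union_inter]
  have : 0 ≤ ∑ x ∈ A ∩ B, f x := Finset.sum_nonneg fun x _ => hf x
  linarith

open Classical in
/-- ★★ **The ten-fibre under five-step extendability weighs at most `4y · X⁵_{j+2}(y)`** (`j ≥ 4`, `y ≥ 0`): split by the four shapes of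
`ten_coords5` and inject each shape into `archsK 5 (j+2)` by the prefix map. [cite: HammersleyTorrieWhittington1982, §2 (as summarised by Beaton 2014 arXiv v3 p. 11; locator provisional); EntingJensen2009, §7.4.2, Fig. 7.10] -/
theorem sum_fibW_ten_le_X5 {j : ℕ} (hj : 4 ≤ j) (hy : 0 ≤ y) :
    ∑ ω ∈ (fibW (j + 8) (j + 2)).filter (ExtK 5 (j + 12)), y ^ visits (j + 12) ω ≤ 4 * y * XKw 5 (j + 2) y := by
  set S := (fibW (j + 8) (j + 2)).filter (ExtK 5 (j + 12)) with hS
  set Sa := S.filter (TenShape tenAD tenAE j)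
  set Sb := S.filter (TenShape tenBD tenBE j)
  set Sc := S.filter (TenShape tenCD tenBE j)
  set Sl := S.filter (TenShape tenLD tenBE j)
  have hcover : S ⊆ Sa ∪ Sb ∪ Sc ∪ Sl := by
    intro ω hω
    obtain ⟨hωf, hE⟩ := Finset.mem_filter.1 hω
    rcases ten_coords5 hj hωf hE le_rfl with h | h | h | h
    · exact Finset.mem_union_left _ (Finset.mem_union_left _ (Finset.mem_union_left _ (Finset.mem_filter.2 ⟨hω, h⟩)))
    · exact Finset.mem_union_left _ (Finset.mem_union_left _ (Finset.mem_union_right _ (Finset.mem_filter.2 ⟨hω, h⟩)))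
    · exact Finset.mem_union_left _ (Finset.mem_union_right _ (Finset.mem_filter.2 ⟨hω, h⟩))
    · exact Finset.mem_union_right _ (Finset.mem_filter.2 ⟨hω, h⟩)
  have hshape : ∀ (d e : ℕ → ℤ), ∑ ω ∈ S.filter (TenShape d e j), y ^ visits (j + 12) ω ≤ y * XKw 5 (j + 2) y := fun d e =>
    sum_shape_le_XK (c := 8) (k := 5) hy (by norm_num) d e _ (Finset.filter_subset _ _)
      fun ω hω => (Finset.mem_filter.1 hω).2
  have hf : ∀ ω : ℕ → Site 2, 0 ≤ y ^ visits (j + 12) ω := fun _ => pow_nonneg hy _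
  calc ∑ ω ∈ S, y ^ visits (j + 12) ω ≤ ∑ ω ∈ Sa ∪ Sb ∪ Sc ∪ Sl, y ^ visits (j + 12) ω :=
        Finset.sum_le_sum_of_subset_of_nonneg hcover fun _ _ _ => pow_nonneg hy _
    _ ≤ ∑ ω ∈ Sa, y ^ visits (j + 12) ω + ∑ ω ∈ Sb, y ^ visits (j + 12) ω + ∑ ω ∈ Sc, y ^ visits (j + 12) ω +
          ∑ ω ∈ Sl, y ^ visits (j + 12) ω := by
        have h1 := sum_union_le_add (Sa ∪ Sb ∪ Sc) Sl _ hf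
        have h2 := sum_union_le_add (Sa ∪ Sb) Sc _ hf
        have h3 := sum_union_le_add Sa Sb _ hf
        linarith
    _ ≤ 4 * y * XKw 5 (j + 2) y := by
        have ha := hshape tenAD tenAE
        have hb := hshape tenBD tenBE
        have hc := hshape tenCD tenBE
        have hl := hshape tenLD tenBE
        linarith

/-! ### §8  The recursion for the five-step-extendable count -/

/-- Shorthand: `X⁵_n(y) := X^{(5)}_n(y)`. [cite: HammersleyTorrieWhittington1982, §2] -/
abbrev X5w (n : ℕ) (y : ℝ) : ℝ := XKw 5 n y

open Classical in
/-- ★★ **THE RECURSION** (`y ≥ 0`, `j ≥ 4`, arches of length `j+12`):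
`X⁵_{j+12} ≤ y X⁵_{j+10} + y X⁵_{j+6} + y X⁵_{j+4} + 4y X⁵_{j+2} + 2y Σ_{t ≤ j} X⁵_t c_{j+11−t}(ℍ)` — the straight block, the dip, the flat
excursion, the FOUR excursions of length ten, and the excursions of length `≥ 12` bounded by all walks; characteristic equation
`1 = yz + yz³ + yz⁴ + 4yz⁵ + O(yz⁶)` at `z = β⁻²`. [cite: HammersleyTorrieWhittington1982, §2 (unfolded surface walks, as summarised by Beaton 2014 arXiv v3 p. 11; locator provisional); JansevanRensburg2000, §3.3.2, Lemma 3.20; MadrasSlade1993, §1.2, (1.2.3)] -/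
theorem X5w_le_rec {j : ℕ} (hj : 4 ≤ j) (hy : 0 ≤ y) :
    X5w (j + 12) y ≤ y * X5w (j + 10) y + y * X5w (j + 6) y + y * X5w (j + 4) y + 4 * y * X5w (j + 2) y +
      2 * y * ∑ t ∈ range (j + 1), X5w t y * #(saws (j + 11 - t)) := by
  classical
  set T : ℕ → ℝ := fun t => ∑ ω ∈ (archsK 5 (j + 12)).filter (fun ω => lastV (j + 10) ω = t), y ^ visits (j + 12) ω with hT
  have hf : ∀ ω ∈ archsK 5 (j + 12), lastV (j + 10) ω ∈ range (j + 11) :=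
    fun ω _ => Finset.mem_range.2 (Nat.lt_succ_of_le (lastV_le _ _))
  have hX : X5w (j + 12) y = ∑ t ∈ range (j + 11), T t := by
    rw [X5w, XKw, ← Finset.sum_fiberwise_of_maps_to hf]
  have hsub : ∀ t, (archsK 5 (j + 12)).filter (fun ω => lastV (j + 10) ω = t) ⊆ (fibW (j + 8) t).filter (ExtK 5 (j + 12)) := by
    intro t ω hω
    obtain ⟨hωX, hl⟩ := Finset.mem_filter.1 hω
    obtain ⟨hωa, hE⟩ := mem_archsK.1 hωX
    refine Finset.mem_filter.2 ⟨Finset.mem_filter.2 ⟨?_, ?_⟩, hE⟩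
    · rw [show j + 8 + 4 = j + 12 by omega]; exact hωa
    · rw [show j + 8 + 2 = j + 10 by omega]; exact hl
  have hTle : ∀ t, T t ≤ ∑ ω ∈ fibW (j + 8) t, y ^ visits (j + 12) ω := fun t =>
    Finset.sum_le_sum_of_subset_of_nonneg ((hsub t).trans (Finset.filter_subset _ _)) fun _ _ _ => pow_nonneg hy _
  have hTle' : ∀ t, T t ≤ ∑ ω ∈ (fibW (j + 8) t).filter (ExtK 5 (j + 12)), y ^ visits (j + 12) ω := fun t =>
    Finset.sum_le_sum_of_subset_of_nonneg (hsub t) fun _ _ _ => pow_nonneg hy _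
  have hT0 : ∀ ω : ℕ → Site 2, visits (j + 8 + 4) ω = visits (j + 12) ω := fun ω => by rw [show j + 8 + 4 = j + 12 by omega]
  -- the straight fibre
  have h10 : T (j + 10) ≤ y * X5w (j + 10) y := by
    refine (hTle' _).trans ?_
    have h := sum_fibW_self_le_XK (k := 5) (j + 8) hy
    rw [show j + 8 + 2 = j + 10 by omega] at h
    simpa only [hT0] using h
  -- empty fibres: odd times and the diagonal
  have hodd : ∀ t, t % 2 = 1 → T t ≤ 0 := fun t ht => (hTle _).trans (by
    refine (Finset.sum_eq_zero fun ω hω => ?_).le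
    obtain ⟨-, -, -, -, hk0, -⟩ := fibW_anatomy hω
    omega)
  have h9 : T (j + 9) ≤ 0 := (hTle _).trans (by
    have h := sum_fibW_eq_zero_of_near (m := j + 8) (k := j + 9) (by omega) (by omega) y
    simpa only [hT0] using h.le)
  have h8 : T (j + 8) ≤ 0 := (hTle _).trans (by
    have h := sum_fibW_eq_zero_of_near (m := j + 8) (k := j + 8) (by omega) (by omega) y
    simpa only [hT0] using h.le)
  have h7 : T (j + 7) ≤ 0 := (hTle _).trans (by
    have h := sum_fibW_eq_zero_of_near (m := j + 8) (k := j + 7) (by omega) (by omega) y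
    simpa only [hT0] using h.le)
  -- parity of `j`: if `j` is odd every arch of length `j+12` is absent and all fibres vanish; we only need the odd fibres
  have h5 : T (j + 5) ≤ 0 := (hTle _).trans (by
    refine (Finset.sum_eq_zero fun ω hω => ?_).le
    obtain ⟨-, hm, -, -, hk0, -⟩ := fibW_anatomy hω
    omega)
  have h3 : T (j + 3) ≤ 0 := (hTle _).trans (by
    refine (Finset.sum_eq_zero fun ω hω => ?_).le
    obtain ⟨-, hm, -, -, hk0, -⟩ := fibW_anatomy hω
    omega)
  have h1 : T (j + 1) ≤ 0 := (hTle _).trans (by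
    refine (Finset.sum_eq_zero fun ω hω => ?_).le
    obtain ⟨-, hm, -, -, hk0, -⟩ := fibW_anatomy hω
    omega)
  -- the dip fibre
  have h6 : T (j + 6) ≤ y * X5w (j + 6) y := by
    refine (hTle' _).trans ?_
    have h := sum_fibW_dip_le_XK (k := 5) (j + 4) hy (by norm_num) (by norm_num)
    rw [show j + 4 + 4 = j + 8 by omega, show j + 4 + 2 = j + 6 by omega, show j + 4 + 8 = j + 12 by omega] at h
    exact h
  -- the flat fibre
  have h4 : T (j + 4) ≤ y * X5w (j + 4) y := by
    refine (hTle' _).trans ?_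
    have h := sum_fibW_flat8_le_XK (k := 5) (j := j + 2) (by omega) hy (by norm_num) (by norm_num)
    rw [show j + 2 + 6 = j + 8 by omega, show j + 2 + 2 = j + 4 by omega, show j + 2 + 10 = j + 12 by omega] at h
    exact h
  -- the ten fibre
  have h2 : T (j + 2) ≤ 4 * y * X5w (j + 2) y := (hTle' _).trans (sum_fibW_ten_le_X5 hj hy)
  -- the long fibres
  have h0 : ∑ t ∈ range (j + 1), T t ≤ 2 * y * ∑ t ∈ range (j + 1), X5w t y * #(saws (j + 11 - t)) := by
    rw [Finset.mul_sum]
    refine Finset.sum_le_sum fun t ht => (hTle t).trans ?_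
    have ht' := Finset.mem_range.1 ht
    have h := sum_fibW_le_XK (k := 5) (j + 8) hy (t := t) (by omega)
    rw [show j + 8 + 3 - t = j + 11 - t by omega] at h
    simpa only [hT0] using h
  rw [hX, Finset.sum_range_succ, Finset.sum_range_succ, Finset.sum_range_succ, Finset.sum_range_succ, Finset.sum_range_succ,
    Finset.sum_range_succ, Finset.sum_range_succ, Finset.sum_range_succ, Finset.sum_range_succ, Finset.sum_range_succ]
  linarith

/-! ### §9  The growth bound -/

open Classical in
/-- A priori: `X⁵_n(y) ≤ 3ⁿ yⁿ` for `y ≥ 1`. [cite: MadrasSlade1993, §1.2, (1.2.3)] -/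
theorem X5w_le_three_pow_mul_pow (n : ℕ) (hy : 1 ≤ y) : X5w n y ≤ 3 ^ n * y ^ n := by
  have hy0 : 0 ≤ y := by linarith
  have h1 := (XKw_le_Aw 5 n hy0).trans (Aw_le_card_mul_pow n hy0)
  rw [max_eq_right hy] at h1
  exact h1.trans (mul_le_mul_of_nonneg_right (Arm.card_saws_le_three_pow n) (pow_nonneg hy0 _))

open Classical in
/-- **The growth bound** (`y ≥ 1`): if `ρ ≥ 6` and `y/ρ² + y/ρ⁶ + y/ρ⁸ + 4y/ρ¹⁰ + 708588·y/ρ¹² ≤ 1` then `X⁵_n(y) ≤ 3¹⁵ y¹⁵ · ρⁿ` for every `n`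
(strong induction on `X5w_le_rec` from `n = 16`; `c_m(ℍ) ≤ 3^m`; geometric tail `Σ_{t ≤ j} ρ^t 3^{j+11−t} ≤ 2·3¹¹ ρ^j`; `708588 = 4·3¹¹`).
[cite: HammersleyTorrieWhittington1982, §2 (as summarised by Beaton 2014 arXiv v3 p. 11; locator provisional); MadrasSlade1993, §1.2, Lemma 1.2.2] -/
theorem X5w_le_mul_pow (hy : 1 ≤ y) {ρ : ℝ} (hρ : 6 ≤ ρ) (hc : y / ρ ^ 2 + y / ρ ^ 6 + y / ρ ^ 8 + 4 * y / ρ ^ 10 + 708588 * y / ρ ^ 12 ≤ 1)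
    (n : ℕ) : X5w n y ≤ 3 ^ 15 * y ^ 15 * ρ ^ n := by
  have hy0 : 0 ≤ y := by linarith
  have hρ1 : 1 ≤ ρ := by linarith
  have hρ0 : 0 < ρ := by linarith
  induction n using Nat.strong_induction_on with
  | _ n ih =>
  rcases Nat.lt_or_ge n 16 with hn | hn
  · have h1 := X5w_le_three_pow_mul_pow n hy
    have h3 : (3 : ℝ) ^ n ≤ 3 ^ 15 := pow_le_pow_right₀ (by norm_num) (by omega)
    have h4 : y ^ n ≤ y ^ 15 := pow_le_pow_right₀ hy (by omega)
    have h5 : (1 : ℝ) ≤ ρ ^ n := one_le_pow₀ hρ1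
    calc X5w n y ≤ 3 ^ n * y ^ n := h1
      _ ≤ 3 ^ 15 * y ^ 15 := mul_le_mul h3 h4 (pow_nonneg hy0 _) (by positivity)
      _ = 3 ^ 15 * y ^ 15 * 1 := (mul_one _).symm
      _ ≤ 3 ^ 15 * y ^ 15 * ρ ^ n := mul_le_mul_of_nonneg_left h5 (by positivity)
  · obtain ⟨j, rfl⟩ : ∃ j, n = j + 12 := ⟨n - 12, by omega⟩
    set M : ℝ := 3 ^ 15 * y ^ 15 with hM
    have hM0 : 0 ≤ M := by positivity
    have hrec := X5w_le_rec (j := j) (by omega) hy0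
    have b10 : X5w (j + 10) y ≤ M * ρ ^ (j + 10) := ih (j + 10) (by omega)
    have b6 : X5w (j + 6) y ≤ M * ρ ^ (j + 6) := ih (j + 6) (by omega)
    have b4 : X5w (j + 4) y ≤ M * ρ ^ (j + 4) := ih (j + 4) (by omega)
    have b2 : X5w (j + 2) y ≤ M * ρ ^ (j + 2) := ih (j + 2) (by omega)
    have bS : ∑ t ∈ range (j + 1), X5w t y * (#(saws (j + 11 - t)) : ℝ) ≤ M * (2 * 3 ^ 11 * ρ ^ j) := by
      calc ∑ t ∈ range (j + 1), X5w t y * (#(saws (j + 11 - t)) : ℝ)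
          ≤ ∑ t ∈ range (j + 1), M * ρ ^ t * 3 ^ (j + 11 - t) := by
            refine Finset.sum_le_sum fun t ht => ?_
            exact mul_le_mul (ih t (by have := Finset.mem_range.1 ht; omega)) (Arm.card_saws_le_three_pow _)
              (by positivity) (by positivity)
        _ = M * ∑ t ∈ range (j + 1), ρ ^ t * 3 ^ (j + 11 - t) := by
            rw [Finset.mul_sum]; exact Finset.sum_congr rfl fun t _ => by ring
        _ ≤ M * (2 * 3 ^ 11 * ρ ^ j) := mul_le_mul_of_nonneg_left (Arm.sum_pow_mul_three_pow_le hρ j 11) hM0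
    have key : y * ρ ^ (j + 10) + y * ρ ^ (j + 6) + y * ρ ^ (j + 4) + 4 * y * ρ ^ (j + 2) + 708588 * y * ρ ^ j ≤ ρ ^ (j + 12) := by
      have h := mul_le_mul_of_nonneg_right hc (pow_nonneg hρ0.le (j + 12))
      rw [one_mul] at h
      have e : (y / ρ ^ 2 + y / ρ ^ 6 + y / ρ ^ 8 + 4 * y / ρ ^ 10 + 708588 * y / ρ ^ 12) * ρ ^ (j + 12) =
          y * ρ ^ (j + 10) + y * ρ ^ (j + 6) + y * ρ ^ (j + 4) + 4 * y * ρ ^ (j + 2) + 708588 * y * ρ ^ j := by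
        field_simp
        ring
      linarith
    have c10 := mul_le_mul_of_nonneg_left b10 hy0
    have c6 := mul_le_mul_of_nonneg_left b6 hy0
    have c4 := mul_le_mul_of_nonneg_left b4 hy0
    have c2 : 4 * y * X5w (j + 2) y ≤ 4 * y * (M * ρ ^ (j + 2)) := mul_le_mul_of_nonneg_left b2 (by positivity)
    have cS : 2 * y * ∑ t ∈ range (j + 1), X5w t y * (#(saws (j + 11 - t)) : ℝ) ≤ 2 * y * (M * (2 * 3 ^ 11 * ρ ^ j)) :=
      mul_le_mul_of_nonneg_left bS (by positivity)
    have key' := mul_le_mul_of_nonneg_left key hM0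
    calc X5w (j + 12) y
        ≤ y * X5w (j + 10) y + y * X5w (j + 6) y + y * X5w (j + 4) y + 4 * y * X5w (j + 2) y +
            2 * y * ∑ t ∈ range (j + 1), X5w t y * (#(saws (j + 11 - t)) : ℝ) := hrec
      _ ≤ y * (M * ρ ^ (j + 10)) + y * (M * ρ ^ (j + 6)) + y * (M * ρ ^ (j + 4)) + 4 * y * (M * ρ ^ (j + 2)) +
            2 * y * (M * (2 * 3 ^ 11 * ρ ^ j)) := by linarith
      _ = M * (y * ρ ^ (j + 10) + y * ρ ^ (j + 6) + y * ρ ^ (j + 4) + 4 * y * ρ ^ (j + 2) + 708588 * y * ρ ^ j) := by ring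
      _ ≤ M * ρ ^ (j + 12) := key'

/-! ### §10  THE FOURTH-ORDER UPPER WINDOW -/

/-- The renewal condition at `B = y + 1/y + 1/y² + 2/y³ + 708591/y⁴` (`y ≥ 1`): `y/B + y/B³ + y/B⁴ + 4y/B⁵ + 708588 y/B⁶ ≤ 1`.  The only
cancellation — between `y/B² = 1/y − 2/y³ + …` and `4y/B⁴ = 4/y³ + …` — is handled with `B ≥ y + 1/y`, everything else with `B ≥ y`;
the remaining polynomial inequality is `3y⁴ + 6y² + 3 ≥ 3y³ + 2y`. [cite: JansevanRensburg2000, §3.3.2, Lemma 3.20; MadrasSlade1993, §1.2, Lemma 1.2.2] -/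
theorem fourthB_condition (hy : 1 ≤ y) :
    y / (y + 1 / y + 1 / y ^ 2 + 2 / y ^ 3 + 708591 / y ^ 4) + y / (y + 1 / y + 1 / y ^ 2 + 2 / y ^ 3 + 708591 / y ^ 4) ^ 3 +
        y / (y + 1 / y + 1 / y ^ 2 + 2 / y ^ 3 + 708591 / y ^ 4) ^ 4 + 4 * y / (y + 1 / y + 1 / y ^ 2 + 2 / y ^ 3 + 708591 / y ^ 4) ^ 5 +
        708588 * y / (y + 1 / y + 1 / y ^ 2 + 2 / y ^ 3 + 708591 / y ^ 4) ^ 6 ≤ 1 := by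
  have hy0 : 0 < y := by linarith
  set B : ℝ := y + 1 / y + 1 / y ^ 2 + 2 / y ^ 3 + 708591 / y ^ 4 with hB
  set u : ℝ := 1 / y + 1 / y ^ 2 + 2 / y ^ 3 + 708591 / y ^ 4 with hu
  have hBu : B = y + u := by rw [hB, hu]; ring
  have hp1 : (0 : ℝ) < 1 / y := by positivity
  have hp2 : (0 : ℝ) ≤ 1 / y ^ 2 := by positivity
  have hp3 : (0 : ℝ) ≤ 2 / y ^ 3 := by positivity
  have hp4 : (0 : ℝ) ≤ 708591 / y ^ 4 := by positivity
  have hyB : y ≤ B := by rw [hB]; linarith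
  have hB1 : y + 1 / y ≤ B := by rw [hB]; linarith
  have hB0 : 0 < B := by linarith
  -- the four terms of `y/B² + y/B³ + 4y/B⁴ + J y/B⁵ ≤ u`
  have t1 : y / B ^ 2 ≤ y ^ 3 / (y ^ 2 + 1) ^ 2 := by
    have e : y ^ 3 / (y ^ 2 + 1) ^ 2 = y / (y + 1 / y) ^ 2 := by field_simp
    rw [e]
    exact div_le_div_of_nonneg_left hy0.le (by positivity) (pow_le_pow_left₀ (by positivity) hB1 2)
  have t2 : y / B ^ 3 ≤ 1 / y ^ 2 := by
    rw [div_le_div_iff₀ (by positivity) (by positivity), one_mul]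
    calc y * y ^ 2 = y ^ 3 := by ring
      _ ≤ B ^ 3 := pow_le_pow_left₀ hy0.le hyB 3
  have t3 : 4 * y / B ^ 4 ≤ 4 / y ^ 3 := by
    rw [div_le_div_iff₀ (by positivity) (by positivity)]
    calc 4 * y * y ^ 3 = 4 * y ^ 4 := by ring
      _ ≤ 4 * B ^ 4 := by nlinarith [pow_le_pow_left₀ hy0.le hyB 4]
  have t4 : 708588 * y / B ^ 5 ≤ 708588 / y ^ 4 := by
    rw [div_le_div_iff₀ (by positivity) (by positivity)]
    calc 708588 * y * y ^ 4 = 708588 * y ^ 5 := by ring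
      _ ≤ 708588 * B ^ 5 := by nlinarith [pow_le_pow_left₀ hy0.le hyB 5]
  have poly : y ^ 3 / (y ^ 2 + 1) ^ 2 + 1 / y ^ 2 + 4 / y ^ 3 + 708588 / y ^ 4 ≤ u := by
    rw [hu, ← sub_nonneg]
    have e : 1 / y + 1 / y ^ 2 + 2 / y ^ 3 + 708591 / y ^ 4 - (y ^ 3 / (y ^ 2 + 1) ^ 2 + 1 / y ^ 2 + 4 / y ^ 3 + 708588 / y ^ 4) =
        (3 * y ^ 4 - 3 * y ^ 3 + 6 * y ^ 2 - 2 * y + 3) / (y ^ 4 * (y ^ 2 + 1) ^ 2) := by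
      field_simp
      ring
    rw [e]
    apply div_nonneg _ (by positivity)
    nlinarith
  have hBy : B - y = u := by rw [hBu]; ring
  have hsum : y / B ^ 2 + y / B ^ 3 + 4 * y / B ^ 4 + 708588 * y / B ^ 5 ≤ B - y := by rw [hBy]; linarith
  -- divide by `B`
  have e : y / B + y / B ^ 3 + y / B ^ 4 + 4 * y / B ^ 5 + 708588 * y / B ^ 6 =
      (y + (y / B ^ 2 + y / B ^ 3 + 4 * y / B ^ 4 + 708588 * y / B ^ 5)) / B := by
    field_simp
    ring
  rw [e, div_le_one hB0]
  linarith

/-- ★★★ **THE FOURTH-ORDER UPPER WINDOW: `β(y)² ≤ y + 1/y + 1/y² + 2/y³ + 708591/y⁴` for every `y ≥ 36`** (the threshold only serves `ρ ≥ 6`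
in the geometric tail).  With `B` the right-hand side and `ρ = √B`: `B^w_n(y) ≤ X⁵_n(y) ≤ 3¹⁵ y¹⁵ ρⁿ` (`fourthB_condition`, `X5w_le_mul_pow`) and
the Fekete transfer `wallRate_le_of_WB_le` give `β(y) ≤ ρ`. [cite: BeatonBousquetMelouDeGierDuminilCopinGuttmann2014, §3.1 (arXiv v5 p. 10: "This translates into μ(y) ∼ √y in our honeycomb setting" — stated without proof); JansevanRensburg2000, §3.3.2, Lemma 3.20] -/
theorem wallRate_sq_le_fourth (hy : 36 ≤ y) : wallRate y ^ 2 ≤ y + 1 / y + 1 / y ^ 2 + 2 / y ^ 3 + 708591 / y ^ 4 := by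
  have hy1 : 1 ≤ y := by linarith
  have hy0 : 0 < y := by linarith
  set B : ℝ := y + 1 / y + 1 / y ^ 2 + 2 / y ^ 3 + 708591 / y ^ 4 with hB
  have hyB : y ≤ B := by
    have h1 : (0 : ℝ) ≤ 1 / y := by positivity
    have h2 : (0 : ℝ) ≤ 1 / y ^ 2 := by positivity
    have h3 : (0 : ℝ) ≤ 2 / y ^ 3 := by positivity
    have h4 : (0 : ℝ) ≤ 708591 / y ^ 4 := by positivity
    rw [hB]; linarith
  have hB36 : 36 ≤ B := hy.trans hyB
  have hB0 : 0 < B := by linarith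
  set ρ := Real.sqrt B with hρ
  have hρ0 : 0 < ρ := Real.sqrt_pos.2 hB0
  have hρsq : ρ ^ 2 = B := Real.sq_sqrt hB0.le
  have hρ6 : 6 ≤ ρ := by
    rw [hρ, ← Real.sqrt_sq (by norm_num : (0 : ℝ) ≤ 6)]
    exact Real.sqrt_le_sqrt (by norm_num; exact hB36)
  have hc : y / ρ ^ 2 + y / ρ ^ 6 + y / ρ ^ 8 + 4 * y / ρ ^ 10 + 708588 * y / ρ ^ 12 ≤ 1 := by
    have h6 : ρ ^ 6 = B ^ 3 := by rw [show (6 : ℕ) = 2 * 3 by norm_num, pow_mul, hρsq]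
    have h8 : ρ ^ 8 = B ^ 4 := by rw [show (8 : ℕ) = 2 * 4 by norm_num, pow_mul, hρsq]
    have h10 : ρ ^ 10 = B ^ 5 := by rw [show (10 : ℕ) = 2 * 5 by norm_num, pow_mul, hρsq]
    have h12 : ρ ^ 12 = B ^ 6 := by rw [show (12 : ℕ) = 2 * 6 by norm_num, pow_mul, hρsq]
    rw [hρsq, h6, h8, h10, h12, show y / B = y / (y + 1 / y + 1 / y ^ 2 + 2 / y ^ 3 + 708591 / y ^ 4) by rw [hB]]
    exact fourthB_condition hy1
  have hA := X5w_le_mul_pow hy1 hρ6 hc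
  have hW : ∀ n, WB n y ≤ 3 ^ 15 * y ^ 15 * ρ ^ n := fun n => (WB_le_XKw 5 n hy0.le).trans (hA n)
  have hβρ : wallRate y ≤ ρ := wallRate_le_of_WB_le hy0 (by positivity) hρ0 hW
  calc wallRate y ^ 2 ≤ ρ ^ 2 := pow_le_pow_left₀ (wallRate_pos y).le hβρ 2
    _ = B := hρsq

/-- ★★★ **`y³ · (β(y)² − y − 1/y − 1/y²) ≤ 2 + 708591/y`** (`y ≥ 36`): `limsup_{y → ∞} y³ (β(y)² − y − 1/y − 1/y²) ≤ 2`.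
[cite: BeatonBousquetMelouDeGierDuminilCopinGuttmann2014, §3.1 (arXiv v5 p. 10 remark); JansevanRensburg2000, §3.3.2, Lemma 3.20] -/
theorem cube_mul_wallRate_sq_sub_le (hy : 36 ≤ y) : y ^ 3 * (wallRate y ^ 2 - y - 1 / y - 1 / y ^ 2) ≤ 2 + 708591 / y := by
  have hy0 : 0 < y := by linarith
  have h := wallRate_sq_le_fourth hy
  have e : y ^ 3 * (wallRate y ^ 2 - y - 1 / y - 1 / y ^ 2) =
      y ^ 3 * (wallRate y ^ 2 - (y + 1 / y + 1 / y ^ 2 + 2 / y ^ 3 + 708591 / y ^ 4)) + (2 + 708591 / y) := by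
    field_simp
    ring
  rw [e]
  have : y ^ 3 * (wallRate y ^ 2 - (y + 1 / y + 1 / y ^ 2 + 2 / y ^ 3 + 708591 / y ^ 4)) ≤ 0 :=
    mul_nonpos_of_nonneg_of_nonpos (pow_nonneg hy0.le 3) (by linarith)
  linarith

/-- ★★★ **`limsup ≤ 2` in the elementary form**: every `a > 2` eventually dominates `y³ (β(y)² − y − 1/y − 1/y²)`.
[cite: BeatonBousquetMelouDeGierDuminilCopinGuttmann2014, §3.1 (arXiv v5 p. 10 remark); JansevanRensburg2000, §3.3.2, Lemma 3.20] -/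
theorem eventually_cube_mul_wallRate_sq_sub_le {a : ℝ} (ha : 2 < a) :
    ∀ᶠ y : ℝ in atTop, y ^ 3 * (wallRate y ^ 2 - y - 1 / y - 1 / y ^ 2) ≤ a := by
  have h1 : ∀ᶠ y : ℝ in atTop, 36 ≤ y := eventually_ge_atTop 36
  have h2 : ∀ᶠ y : ℝ in atTop, 708591 / (a - 2) ≤ y := eventually_ge_atTop _
  filter_upwards [h1, h2] with y hy hy2
  have hy0 : 0 < y := by linarith
  have h := cube_mul_wallRate_sq_sub_le hy
  have h3 : 708591 / y ≤ a - 2 := by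
    rw [div_le_iff₀ hy0]
    have := (div_le_iff₀ (by linarith : (0:ℝ) < a - 2)).1 hy2
    linarith
  linarith

/-- ★★ **The fourth-order window with the tree's second-order-sharp lower side**: for `y ≥ 36`,
`β(y)² − y − 1/y − 1/y² ∈ [−(26247/y³ + 1/y²), 2/y³ + 708591/y⁴]` (lower end from `sharp_lower_window : y + 1/y − 26247/y³ ≤ β²`, coarse;
the companion «WALL-FOURTH-ORDER-LOWER» has the sharp lower side `2/y³ − 192476/y⁴`).
[cite: BeatonBousquetMelouDeGierDuminilCopinGuttmann2014, §3.1 (arXiv v5 p. 10 remark); JansevanRensburg2000, §3.3.2, Lemma 3.20] -/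
theorem wallRate_sq_fourth_upper_mem_Icc (hy : 36 ≤ y) :
    wallRate y ^ 2 - y - 1 / y - 1 / y ^ 2 ∈ Set.Icc (-(26247 / y ^ 3 + 1 / y ^ 2)) (2 / y ^ 3 + 708591 / y ^ 4) := by
  have hy1 : 1 ≤ y := by linarith
  refine ⟨?_, ?_⟩
  · have h := sharp_lower_window hy1; linarith
  · have h := wallRate_sq_le_fourth hy; linarith

/-! ### §11  The same for BBdGDCG's `μ(y)` -/

/-- ★★★ **`μ(y)² ≤ y + 1/y + 1/y² + 2/y³ + 708591/y⁴`** (`y ≥ 36`) for BBdGDCG's `μ(y) = HV.surfaceMu y`.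
[cite: BeatonBousquetMelouDeGierDuminilCopinGuttmann2014, §3.1, Proposition 5 (arXiv v5 p. 9); p. 10 (first-order remark)] [cite: JansevanRensburg2000, §3.3.2, Lemma 3.20] -/
theorem surfaceMu_sq_le_fourth (hy : 36 ≤ y) : HV.surfaceMu y ^ 2 ≤ y + 1 / y + 1 / y ^ 2 + 2 / y ^ 3 + 708591 / y ^ 4 := by
  rw [← HV.wallRate_eq_surfaceMu (by linarith)]
  exact wallRate_sq_le_fourth hy

/-- ★★★ **`y³ (μ(y)² − y − 1/y − 1/y²) ≤ 2 + 708591/y`** (`y ≥ 36`). [cite: BeatonBousquetMelouDeGierDuminilCopinGuttmann2014, §3.1, Proposition 5 (arXiv v5 p. 9); p. 10 (first-order remark)] [cite: JansevanRensburg2000, §3.3.2, Lemma 3.20] -/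
theorem cube_mul_surfaceMu_sq_sub_le (hy : 36 ≤ y) : y ^ 3 * (HV.surfaceMu y ^ 2 - y - 1 / y - 1 / y ^ 2) ≤ 2 + 708591 / y := by
  rw [← HV.wallRate_eq_surfaceMu (by linarith)]
  exact cube_mul_wallRate_sq_sub_le hy

/-- ★★★ **`limsup_{y→∞} y³ (μ(y)² − y − 1/y − 1/y²) ≤ 2`** (elementary form). [cite: BeatonBousquetMelouDeGierDuminilCopinGuttmann2014, §3.1, Proposition 5 (arXiv v5 p. 9); p. 10 (first-order remark)] [cite: JansevanRensburg2000, §3.3.2, Lemma 3.20] -/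
theorem eventually_cube_mul_surfaceMu_sq_sub_le {a : ℝ} (ha : 2 < a) :
    ∀ᶠ y : ℝ in atTop, y ^ 3 * (HV.surfaceMu y ^ 2 - y - 1 / y - 1 / y ^ 2) ≤ a := by
  filter_upwards [eventually_cube_mul_wallRate_sq_sub_le ha, eventually_gt_atTop 0] with y h hy0
  rwa [HV.wallRate_eq_surfaceMu hy0] at h

end Literature.Probability.RandomPlanarGeometry.SAW.HexBW.Wall
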